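import Literature.NumberTheory.Sieve.PolymathGEHCutoffBasic
import Literature.NumberTheory.Sieve.PolymathGEHCells
import Mathlib.Tactic.Ring
import Mathlib.Tactic.Linarith
import Mathlib.Tactic.IntervalCases
import HarnessLib

/-!
# Polymath 8b, Theorem 3.15: the `z`-fibres of the cutoff and its marginal `m(x, y)`

Trunk AntSieve, continuation of `PolymathGEHCutoffDef/Basic.lean` and `PolymathGEHCells.lean`
(D. H. J. Polymath, *Variants of the Selberg sieve, and bounded intervals containing many primes*,
Res. Math. Sci. 1:12 (2014) = arXiv:1407.4897, Theorem 3.15, §7.4 pp. 33–34), toward the named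
fact `Literature.NumberTheory.Sieve.weakDHL_three_two_of_GEH` (Theorem 3.2(xii)).

Both remaining quantities of Theorem 3.15 — `J(F) = 3 ∫_{x+y ≤ 1-ε} (∫ F dz)² dx dy` (7.10) and the
vanishing marginal condition `∫ F(x,y,z) dz = 0` for `x + y > 1 + ε` (7.8) — are statements about
the **marginal** `m(x,y) := ∫_{u>0} F(x,y,u) du` (`GEHCutoff.mfun`).  §7.4 computes it region by
region: for `(x, y)` in one of the eight regions of the displays `J₁, …, J₈` (p. 33) or of the
marginal conditions (7.12)–(7.17) (p. 34), the fibre `u ↦ (x, y, u)` crosses an explicit chain of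
polytopes `A_{yzx}, A_{zyx}, A_{xyz}, B_{xyz}, …` between explicit affine breakpoints, and `m(x,y)`
is the corresponding sum of exact integrals of polynomials.  This file PROVES exactly that:

* kernel data `qfA_yzx, …` — the piece met on a permuted polytope `P_{σ}` as a `Q3` list in the
  order `(x, y, z)` (convention actually used here and below: `(x,y,z) ∈ P_{yzx} ⟺ (y,z,x) ∈ P_{xyz}`,
  and there `F = F↾P(y,z,x)`; likewise `P_{zyx}` with `(z,y,x)` — the reading under which the
  displays `J₁`–`J₈` hold and the printed `I(F)`, `J(F)` are reproduced), with bridge lemmas;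
* `F3_fibre_…` — the value of `F3 (x, y, u)` on each such polytope (from `F3_eq_…`,
  `Gfun_eq_of_mem_piece…`: linear arithmetic);
* for each of the fourteen regions (`Q1`–`Q8`: the `J`-regions below the diagonal, p. 33;
  `R1, R3, R4, R5, R6, R7`: the open cells of `{0 < y < x, 5/4 < x + y < 3/2}` on which the fibre
  type is constant, p. 34) the breakpoints `a…`, pieces `g…`, the marginal polynomial `M… : Q2`
  (an exact `Q2` term) and **`mfun_… : m(x,y) = M…(x,y)`** on the open region, via
  `setIntegral_Ioi_eq_sum_of_piecewise` and `integral_leval`.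

Downstream (`PolymathGEHCutoffJ.lean`, `…Marginals.lean`): `J_{3,3/4}(F) ≥ 2Σ_m ∫_{Q_m} M_{Q_m}²`
(kernel-evaluated, `= J(F)/3`) and `M_{R_k} ≡ 0` (kernel: `Q2.isZero`).

## References

* [Polymath8b2014] D. H. J. Polymath, Res. Math. Sci. 1 (2014), Art. 12 = arXiv:1407.4897,
  §7.4 (pp. 33–34), Theorem 3.15.
-/

noncomputable section

open MeasureTheory intervalIntegral

namespace Literature.NumberTheory.Sieve

namespace GEHCutoff
/-! ### Kernel data: the pieces met by the fibres, as `Q3` lists in the order `(x, y, z)` -/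

/-- Data: `(x,y,z) ↦ F↾A(y,z,x)` (the value of `F` on `A_{yzx}`) as a `Q3` polynomial in `(u,v,w) = (x,y,z)`. [cite: Polymath8b2014, Section 7.4] -/
def qfA_yzx : Q3 :=
  [[[(-66), 99, (-112), 50], [96, (-58), 24], [(-147), 63], [125]], [[128, (-98), 72], [(-122), 51], [104]], [[(-275), 41]], [[394]]]

/-- Bridge: `qfA_yzx` evaluates to the printed polynomial. [cite: Polymath8b2014, Section 7.4] -/
theorem ev3_qfA_yzx (u v w : ℝ) : ev3 u v w qfA_yzx = polyA v w u := by
  simp only [qfA_yzx, polyA, ev3, ev2, ev1, leval, List.foldr]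
  push_cast
  ring

/-- Data: `(x,y,z) ↦ F↾A(z,y,x)` (the value of `F` on `A_{zyx}`) as a `Q3` polynomial in `(u,v,w) = (x,y,z)`. [cite: Polymath8b2014, Section 7.4] -/
def qfA_zyx : Q3 :=
  [[[(-66), 99, (-112), 50], [128, (-98), 72], [(-275), 41], [394]], [[96, (-58), 24], [(-122), 51]], [[(-147), 63], [104]], [[125]]]

/-- Bridge: `qfA_zyx` evaluates to the printed polynomial. [cite: Polymath8b2014, Section 7.4] -/
theorem ev3_qfA_zyx (u v w : ℝ) : ev3 u v w qfA_zyx = polyA w v u := by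
  simp only [qfA_zyx, polyA, ev3, ev2, ev1, leval, List.foldr]
  push_cast
  ring

/-- Data: `(x,y,z) ↦ F↾A(x,y,z)` (the value of `F` on `A_{xyz}`) as a `Q3` polynomial in `(u,v,w) = (x,y,z)`. [cite: Polymath8b2014, Section 7.4] -/
def qfA_xyz : Q3 :=
  [[[(-66), 96, (-147), 125], [128, (-122), 104], [(-275)], [394]], [[99, (-58), 63], [(-98), 51], [41]], [[(-112), 24], [72]], [[50]]]

/-- Bridge: `qfA_xyz` evaluates to the printed polynomial. [cite: Polymath8b2014, Section 7.4] -/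
theorem ev3_qfA_xyz (u v w : ℝ) : ev3 u v w qfA_xyz = polyA u v w := by
  simp only [qfA_xyz, polyA, ev3, ev2, ev1, leval, List.foldr]
  push_cast
  ring

/-- Data: `(x,y,z) ↦ F↾B(x,y,z)` (the value of `F` on `B_{xyz}`) as a `Q3` polynomial in `(u,v,w) = (x,y,z)`. [cite: Polymath8b2014, Section 7.4] -/
def qfB_xyz : Q3 :=
  [[[(-41), 52, (-73), 25], [108, (-66), 71], [(-294), 56], [363]], [[33, 15, 22], [(-40), (-42)], [75]], [[(-36), (-24)], [26]], [[20]]]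

/-- Bridge: `qfB_xyz` evaluates to the printed polynomial. [cite: Polymath8b2014, Section 7.4] -/
theorem ev3_qfB_xyz (u v w : ℝ) : ev3 u v w qfB_xyz = polyB u v w := by
  simp only [qfB_xyz, polyB, ev3, ev2, ev1, leval, List.foldr]
  push_cast
  ring

/-- Data: `(x,y,z) ↦ F↾C(x,y,z)` (the value of `F` on `C_{xyz}`) as a `Q3` polynomial in `(u,v,w) = (x,y,z)`. [cite: Polymath8b2014, Section 7.4] -/
def qfC_xyz : Q3 :=
  [[[(-22), 45, (-35)], [63, (-99), 82], [(-140), 54], [179]]]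

/-- Bridge: `qfC_xyz` evaluates to the printed polynomial. [cite: Polymath8b2014, Section 7.4] -/
theorem ev3_qfC_xyz (u v w : ℝ) : ev3 u v w qfC_xyz = polyC u v w := by
  simp only [qfC_xyz, polyC, ev3, ev2, ev1, leval, List.foldr]
  push_cast
  ring

/-- Data: `(x,y,z) ↦ F↾U(x,y,z)` (the value of `F` on `U_{xyz}`) as a `Q3` polynomial in `(u,v,w) = (x,y,z)`. [cite: Polymath8b2014, Section 7.4] -/
def qfU_xyz : Q3 :=
  [[[94, (-1823), 5760, (-5128)], [54, 0, (-168)], [105]], [[0, 1422, (-2340)], [], [(-192)]], [[(-128), (-268)]], [[64]]]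

/-- Bridge: `qfU_xyz` evaluates to the printed polynomial. [cite: Polymath8b2014, Section 7.4] -/
theorem ev3_qfU_xyz (u v w : ℝ) : ev3 u v w qfU_xyz = polyU u v w := by
  simp only [qfU_xyz, polyU, ev3, ev2, ev1, leval, List.foldr]
  push_cast
  ring

/-- Data: `(x,y,z) ↦ F↾G(x,y,z)` (the value of `F` on `G_{xyz}`) as a `Q3` polynomial in `(u,v,w) = (x,y,z)`. [cite: Polymath8b2014, Section 7.4] -/
def qfG_xyz : Q3 :=
  [[[5274, (-19833), 18570, (-5128)], [(-18024), 44696, (-20664)], [16158, (-19056)], [(-4592)]], [[(-10704), 26860, (-12588)], [24448, (-30352)], [(-10980)]], [[7240, (-9092)], [(-8288)]], [[(-1632)]]]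

/-- Bridge: `qfG_xyz` evaluates to the printed polynomial. [cite: Polymath8b2014, Section 7.4] -/
theorem ev3_qfG_xyz (u v w : ℝ) : ev3 u v w qfG_xyz = polyG u v w := by
  simp only [qfG_xyz, polyG, ev3, ev2, ev1, leval, List.foldr]
  push_cast
  ring

/-- Data: `(x,y,z) ↦ F↾T(x,y,z)` (the value of `F` on `T_{xyz}`) as a `Q3` polynomial in `(u,v,w) = (x,y,z)`. [cite: Polymath8b2014, Section 7.4] -/
def qfT_xyz : Q3 :=
  [[[18, (-30), 12], [42, (-20)], [(-66)]], [[(-45), 34]], [[22]]]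

/-- Bridge: `qfT_xyz` evaluates to the printed polynomial. [cite: Polymath8b2014, Section 7.4] -/
theorem ev3_qfT_xyz (u v w : ℝ) : ev3 u v w qfT_xyz = polyT u v w := by
  simp only [qfT_xyz, polyT, ev3, ev2, ev1, leval, List.foldr]
  push_cast
  ring

/-- Data: `(x,y,z) ↦ F↾B(z,y,x)` (the value of `F` on `B_{zyx}`) as a `Q3` polynomial in `(u,v,w) = (x,y,z)`. [cite: Polymath8b2014, Section 7.4] -/
def qfB_zyx : Q3 :=
  [[[(-41), 33, (-36), 20], [108, (-40), 26], [(-294), 75], [363]], [[52, 15, (-24)], [(-66), (-42)], [56]], [[(-73), 22], [71]], [[25]]]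

/-- Bridge: `qfB_zyx` evaluates to the printed polynomial. [cite: Polymath8b2014, Section 7.4] -/
theorem ev3_qfB_zyx (u v w : ℝ) : ev3 u v w qfB_zyx = polyB w v u := by
  simp only [qfB_zyx, polyB, ev3, ev2, ev1, leval, List.foldr]
  push_cast
  ring

/-- Data: `(x,y,z) ↦ F↾S(x,y,z)` (the value of `F` on `S_{xyz}`) as a `Q3` polynomial in `(u,v,w) = (x,y,z)`. [cite: Polymath8b2014, Section 7.4] -/
def qfS_xyz : Q3 :=
  [[[(-6), 8], [16]]]

/-- Bridge: `qfS_xyz` evaluates to the printed polynomial. [cite: Polymath8b2014, Section 7.4] -/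
theorem ev3_qfS_xyz (u v w : ℝ) : ev3 u v w qfS_xyz = polyS u v w := by
  simp only [qfS_xyz, polyS, ev3, ev2, ev1, leval, List.foldr]
  push_cast
  ring

/-- Data: `(x,y,z) ↦ F↾E(x,y,z)` (the value of `F` on `E_{xyz}`) as a `Q3` polynomial in `(u,v,w) = (x,y,z)`. [cite: Polymath8b2014, Section 7.4] -/
def qfE_xyz : Q3 :=
  [[[(-12), 8], [32]]]

/-- Bridge: `qfE_xyz` evaluates to the printed polynomial. [cite: Polymath8b2014, Section 7.4] -/
theorem ev3_qfE_xyz (u v w : ℝ) : ev3 u v w qfE_xyz = polyE u v w := by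
  simp only [qfE_xyz, polyE, ev3, ev2, ev1, leval, List.foldr]
  push_cast
  ring

/-- Data: `(x,y,z) ↦ F↾E(z,y,x)` (the value of `F` on `E_{zyx}`) as a `Q3` polynomial in `(u,v,w) = (x,y,z)`. [cite: Polymath8b2014, Section 7.4] -/
def qfE_zyx : Q3 :=
  [[[(-12)], [32]], [[8]]]

/-- Bridge: `qfE_zyx` evaluates to the printed polynomial. [cite: Polymath8b2014, Section 7.4] -/
theorem ev3_qfE_zyx (u v w : ℝ) : ev3 u v w qfE_zyx = polyE w v u := by
  simp only [qfE_zyx, polyE, ev3, ev2, ev1, leval, List.foldr]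
  push_cast
  ring

/-- Data: `(x,y,z) ↦ F↾E(y,z,x)` (the value of `F` on `E_{yzx}`) as a `Q3` polynomial in `(u,v,w) = (x,y,z)`. [cite: Polymath8b2014, Section 7.4] -/
def qfE_yzx : Q3 :=
  [[[(-12)], [8]], [[32]]]

/-- Bridge: `qfE_yzx` evaluates to the printed polynomial. [cite: Polymath8b2014, Section 7.4] -/
theorem ev3_qfE_yzx (u v w : ℝ) : ev3 u v w qfE_yzx = polyE v w u := by
  simp only [qfE_yzx, polyE, ev3, ev2, ev1, leval, List.foldr]
  push_cast
  ring

/-- Data: `(x,y,z) ↦ F↾S(y,z,x)` (the value of `F` on `S_{yzx}`) as a `Q3` polynomial in `(u,v,w) = (x,y,z)`. [cite: Polymath8b2014, Section 7.4] -/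
def qfS_yzx : Q3 :=
  [[[(-6)], [8]], [[16]]]

/-- Bridge: `qfS_yzx` evaluates to the printed polynomial. [cite: Polymath8b2014, Section 7.4] -/
theorem ev3_qfS_yzx (u v w : ℝ) : ev3 u v w qfS_yzx = polyS v w u := by
  simp only [qfS_yzx, polyS, ev3, ev2, ev1, leval, List.foldr]
  push_cast
  ring

/-- Data: `(x,y,z) ↦ F↾H(y,z,x)` (the value of `F` on `H_{yzx}`) as a `Q3` polynomial in `(u,v,w) = (x,y,z)`. [cite: Polymath8b2014, Section 7.4] -/
def qfH_yzx : Q3 :=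
  [[[0, 8]]]

/-- Bridge: `qfH_yzx` evaluates to the printed polynomial. [cite: Polymath8b2014, Section 7.4] -/
theorem ev3_qfH_yzx (u v w : ℝ) : ev3 u v w qfH_yzx = polyH v w u := by
  simp only [qfH_yzx, polyH, ev3, ev2, ev1, leval, List.foldr]
  push_cast
  ring

/-- Data: `(x,y,z) ↦ F↾T(y,z,x)` (the value of `F` on `T_{yzx}`) as a `Q3` polynomial in `(u,v,w) = (x,y,z)`. [cite: Polymath8b2014, Section 7.4] -/
def qfT_yzx : Q3 :=
  [[[18, (-45), 22], [(-30), 34], [12]], [[42], [(-20)]], [[(-66)]]]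

/-- Bridge: `qfT_yzx` evaluates to the printed polynomial. [cite: Polymath8b2014, Section 7.4] -/
theorem ev3_qfT_yzx (u v w : ℝ) : ev3 u v w qfT_yzx = polyT v w u := by
  simp only [qfT_yzx, polyT, ev3, ev2, ev1, leval, List.foldr]
  push_cast
  ring

/-- Data: `(x,y,z) ↦ F↾U(y,z,x)` (the value of `F` on `U_{yzx}`) as a `Q3` polynomial in `(u,v,w) = (x,y,z)`. [cite: Polymath8b2014, Section 7.4] -/
def qfU_yzx : Q3 :=
  [[[94, 0, (-128), 64], [(-1823), 1422, (-268)], [5760, (-2340)], [(-5128)]], [[54], [], [(-168)]], [[105, (-192)]]]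

/-- Bridge: `qfU_yzx` evaluates to the printed polynomial. [cite: Polymath8b2014, Section 7.4] -/
theorem ev3_qfU_yzx (u v w : ℝ) : ev3 u v w qfU_yzx = polyU v w u := by
  simp only [qfU_yzx, polyU, ev3, ev2, ev1, leval, List.foldr]
  push_cast
  ring

/-- Data: `(x,y,z) ↦ F↾G(y,z,x)` (the value of `F` on `G_{yzx}`) as a `Q3` polynomial in `(u,v,w) = (x,y,z)`. [cite: Polymath8b2014, Section 7.4] -/
def qfG_yzx : Q3 :=
  [[[5274, (-10704), 7240, (-1632)], [(-19833), 26860, (-9092)], [18570, (-12588)], [(-5128)]], [[(-18024), 24448, (-8288)], [44696, (-30352)], [(-20664)]], [[16158, (-10980)], [(-19056)]], [[(-4592)]]]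

/-- Bridge: `qfG_yzx` evaluates to the printed polynomial. [cite: Polymath8b2014, Section 7.4] -/
theorem ev3_qfG_yzx (u v w : ℝ) : ev3 u v w qfG_yzx = polyG v w u := by
  simp only [qfG_yzx, polyG, ev3, ev2, ev1, leval, List.foldr]
  push_cast
  ring

/-- Data: `(x,y,z) ↦ F↾G(z,y,x)` (the value of `F` on `G_{zyx}`) as a `Q3` polynomial in `(u,v,w) = (x,y,z)`. [cite: Polymath8b2014, Section 7.4] -/
def qfG_zyx : Q3 :=
  [[[5274, (-10704), 7240, (-1632)], [(-18024), 24448, (-8288)], [16158, (-10980)], [(-4592)]], [[(-19833), 26860, (-9092)], [44696, (-30352)], [(-19056)]], [[18570, (-12588)], [(-20664)]], [[(-5128)]]]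

/-- Bridge: `qfG_zyx` evaluates to the printed polynomial. [cite: Polymath8b2014, Section 7.4] -/
theorem ev3_qfG_zyx (u v w : ℝ) : ev3 u v w qfG_zyx = polyG w v u := by
  simp only [qfG_zyx, polyG, ev3, ev2, ev1, leval, List.foldr]
  push_cast
  ring

/-! ### `F3` along a fibre `u ↦ (x, y, u)` inside each polytope it meets -/

/-- On `A_{yzx}` the fibre value is `F↾A(y,z,x)`. [cite: Polymath8b2014, Section 7.4] -/
theorem F3_fibre_A_yzx {x y u : ℝ} (h0 : 0 < u) (h1 : u < y) (h2 : y < x) (h3 : y + u + x < 3/2) (h4 : x + y < 3/4) :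
    F3 ![x, y, u] = ev3 x y u qfA_yzx := by
  rw [F3_eq_120 (t := ![x, y, u]) (by
    simp only [Matrix.cons_val_zero, Matrix.cons_val_one, Matrix.cons_val_two, Matrix.head_cons, Matrix.tail_cons]
    exact ⟨h0, h1, h2⟩)]
  simp only [Matrix.cons_val_zero, Matrix.cons_val_one, Matrix.cons_val_two, Matrix.head_cons, Matrix.tail_cons]
  rw [Gfun_eq_of_mem_pieceA (by
    simp only [pieceA, Set.mem_setOf_eq, Matrix.cons_val_zero, Matrix.cons_val_one, Matrix.cons_val_two,
      Matrix.head_cons, Matrix.tail_cons]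
    exact ⟨⟨h0, h1, h2, h3⟩, h4⟩)]
  simp only [Matrix.cons_val_zero, Matrix.cons_val_one, Matrix.cons_val_two, Matrix.head_cons, Matrix.tail_cons,
    ev3_qfA_yzx]

/-- On `A_{zyx}` the fibre value is `F↾A(z,y,x)`. [cite: Polymath8b2014, Section 7.4] -/
theorem F3_fibre_A_zyx {x y u : ℝ} (h0 : 0 < y) (h1 : y < u) (h2 : u < x) (h3 : u + y + x < 3/2) (h4 : x + u < 3/4) :
    F3 ![x, y, u] = ev3 x y u qfA_zyx := by
  rw [F3_eq_210 (t := ![x, y, u]) (by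
    simp only [Matrix.cons_val_zero, Matrix.cons_val_one, Matrix.cons_val_two, Matrix.head_cons, Matrix.tail_cons]
    exact ⟨h0, h1, h2⟩)]
  simp only [Matrix.cons_val_zero, Matrix.cons_val_one, Matrix.cons_val_two, Matrix.head_cons, Matrix.tail_cons]
  rw [Gfun_eq_of_mem_pieceA (by
    simp only [pieceA, Set.mem_setOf_eq, Matrix.cons_val_zero, Matrix.cons_val_one, Matrix.cons_val_two,
      Matrix.head_cons, Matrix.tail_cons]
    exact ⟨⟨h0, h1, h2, h3⟩, h4⟩)]
  simp only [Matrix.cons_val_zero, Matrix.cons_val_one, Matrix.cons_val_two, Matrix.head_cons, Matrix.tail_cons,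
    ev3_qfA_zyx]

/-- On `A_{xyz}` the fibre value is `F↾A(x,y,z)`. [cite: Polymath8b2014, Section 7.4] -/
theorem F3_fibre_A_xyz {x y u : ℝ} (h0 : 0 < y) (h1 : y < x) (h2 : x < u) (h3 : x + y + u < 3/2) (h4 : u + x < 3/4) :
    F3 ![x, y, u] = ev3 x y u qfA_xyz := by
  rw [F3_eq_012 (t := ![x, y, u]) (by
    simp only [Matrix.cons_val_zero, Matrix.cons_val_one, Matrix.cons_val_two, Matrix.head_cons, Matrix.tail_cons]
    exact ⟨h0, h1, h2⟩)]
  simp only [Matrix.cons_val_zero, Matrix.cons_val_one, Matrix.cons_val_two, Matrix.head_cons, Matrix.tail_cons]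
  rw [Gfun_eq_of_mem_pieceA (by
    simp only [pieceA, Set.mem_setOf_eq, Matrix.cons_val_zero, Matrix.cons_val_one, Matrix.cons_val_two,
      Matrix.head_cons, Matrix.tail_cons]
    exact ⟨⟨h0, h1, h2, h3⟩, h4⟩)]
  simp only [Matrix.cons_val_zero, Matrix.cons_val_one, Matrix.cons_val_two, Matrix.head_cons, Matrix.tail_cons,
    ev3_qfA_xyz]

/-- On `B_{xyz}` the fibre value is `F↾B(x,y,z)`. [cite: Polymath8b2014, Section 7.4] -/
theorem F3_fibre_B_xyz {x y u : ℝ} (h0 : 0 < y) (h1 : y < x) (h2 : x < u) (h3 : x + y + u < 3/2) (h4 : y + u < 3/4) (h5 : 3/4 < u + x) (h6 : u + x < 5/4) :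
    F3 ![x, y, u] = ev3 x y u qfB_xyz := by
  rw [F3_eq_012 (t := ![x, y, u]) (by
    simp only [Matrix.cons_val_zero, Matrix.cons_val_one, Matrix.cons_val_two, Matrix.head_cons, Matrix.tail_cons]
    exact ⟨h0, h1, h2⟩)]
  simp only [Matrix.cons_val_zero, Matrix.cons_val_one, Matrix.cons_val_two, Matrix.head_cons, Matrix.tail_cons]
  rw [Gfun_eq_of_mem_pieceB (by
    simp only [pieceB, Set.mem_setOf_eq, Matrix.cons_val_zero, Matrix.cons_val_one, Matrix.cons_val_two,
      Matrix.head_cons, Matrix.tail_cons]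
    exact ⟨⟨h0, h1, h2, h3⟩, ⟨h4, h5, h6⟩⟩)]
  simp only [Matrix.cons_val_zero, Matrix.cons_val_one, Matrix.cons_val_two, Matrix.head_cons, Matrix.tail_cons,
    ev3_qfB_xyz]

/-- On `C_{xyz}` the fibre value is `F↾C(x,y,z)`. [cite: Polymath8b2014, Section 7.4] -/
theorem F3_fibre_C_xyz {x y u : ℝ} (h0 : 0 < y) (h1 : y < x) (h2 : x < u) (h3 : x + y + u < 3/2) (h4 : x + y < 3/4) (h5 : 3/4 < y + u) (h6 : u + x < 5/4) :
    F3 ![x, y, u] = ev3 x y u qfC_xyz := by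
  rw [F3_eq_012 (t := ![x, y, u]) (by
    simp only [Matrix.cons_val_zero, Matrix.cons_val_one, Matrix.cons_val_two, Matrix.head_cons, Matrix.tail_cons]
    exact ⟨h0, h1, h2⟩)]
  simp only [Matrix.cons_val_zero, Matrix.cons_val_one, Matrix.cons_val_two, Matrix.head_cons, Matrix.tail_cons]
  rw [Gfun_eq_of_mem_pieceC (by
    simp only [pieceC, Set.mem_setOf_eq, Matrix.cons_val_zero, Matrix.cons_val_one, Matrix.cons_val_two,
      Matrix.head_cons, Matrix.tail_cons]
    exact ⟨⟨h0, h1, h2, h3⟩, ⟨h4, h5, h6⟩⟩)]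
  simp only [Matrix.cons_val_zero, Matrix.cons_val_one, Matrix.cons_val_two, Matrix.head_cons, Matrix.tail_cons,
    ev3_qfC_xyz]

/-- On `U_{xyz}` the fibre value is `F↾U(x,y,z)`. [cite: Polymath8b2014, Section 7.4] -/
theorem F3_fibre_U_xyz {x y u : ℝ} (h0 : 0 < y) (h1 : y < x) (h2 : x < u) (h3 : x + y + u < 3/2) (h4 : x + y < 3/4) (h5 : 3/4 < y + u) (h6 : y + u < 5/4) (h7 : 5/4 < u + x) (h8 : x < 1/4) :
    F3 ![x, y, u] = ev3 x y u qfU_xyz := by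
  rw [F3_eq_012 (t := ![x, y, u]) (by
    simp only [Matrix.cons_val_zero, Matrix.cons_val_one, Matrix.cons_val_two, Matrix.head_cons, Matrix.tail_cons]
    exact ⟨h0, h1, h2⟩)]
  simp only [Matrix.cons_val_zero, Matrix.cons_val_one, Matrix.cons_val_two, Matrix.head_cons, Matrix.tail_cons]
  rw [Gfun_eq_of_mem_pieceU (by
    simp only [pieceU, Set.mem_setOf_eq, Matrix.cons_val_zero, Matrix.cons_val_one, Matrix.cons_val_two,
      Matrix.head_cons, Matrix.tail_cons]
    exact ⟨⟨h0, h1, h2, h3⟩, ⟨h4, h5, h6, h7, h8⟩⟩)]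
  simp only [Matrix.cons_val_zero, Matrix.cons_val_one, Matrix.cons_val_two, Matrix.head_cons, Matrix.tail_cons,
    ev3_qfU_xyz]

/-- On `G_{xyz}` the fibre value is `F↾G(x,y,z)`. [cite: Polymath8b2014, Section 7.4] -/
theorem F3_fibre_G_xyz {x y u : ℝ} (h0 : 0 < y) (h1 : y < x) (h2 : x < u) (h3 : x + y + u < 3/2) (h4 : x + y < 3/4) (h5 : 5/4 < y + u) :
    F3 ![x, y, u] = ev3 x y u qfG_xyz := by
  rw [F3_eq_012 (t := ![x, y, u]) (by
    simp only [Matrix.cons_val_zero, Matrix.cons_val_one, Matrix.cons_val_two, Matrix.head_cons, Matrix.tail_cons]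
    exact ⟨h0, h1, h2⟩)]
  simp only [Matrix.cons_val_zero, Matrix.cons_val_one, Matrix.cons_val_two, Matrix.head_cons, Matrix.tail_cons]
  rw [Gfun_eq_of_mem_pieceG (by
    simp only [pieceG, Set.mem_setOf_eq, Matrix.cons_val_zero, Matrix.cons_val_one, Matrix.cons_val_two,
      Matrix.head_cons, Matrix.tail_cons]
    exact ⟨⟨h0, h1, h2, h3⟩, ⟨h4, h5⟩⟩)]
  simp only [Matrix.cons_val_zero, Matrix.cons_val_one, Matrix.cons_val_two, Matrix.head_cons, Matrix.tail_cons,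
    ev3_qfG_xyz]

/-- On `T_{xyz}` the fibre value is `F↾T(x,y,z)`. [cite: Polymath8b2014, Section 7.4] -/
theorem F3_fibre_T_xyz {x y u : ℝ} (h0 : 0 < y) (h1 : y < x) (h2 : x < u) (h3 : x + y + u < 3/2) (h4 : x + y < 3/4) (h5 : 3/4 < y + u) (h6 : y + u < 5/4) (h7 : 5/4 < u + x) (h8 : 3/4 < u) (h9 : 1/4 < x) :
    F3 ![x, y, u] = ev3 x y u qfT_xyz := by
  rw [F3_eq_012 (t := ![x, y, u]) (by
    simp only [Matrix.cons_val_zero, Matrix.cons_val_one, Matrix.cons_val_two, Matrix.head_cons, Matrix.tail_cons]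
    exact ⟨h0, h1, h2⟩)]
  simp only [Matrix.cons_val_zero, Matrix.cons_val_one, Matrix.cons_val_two, Matrix.head_cons, Matrix.tail_cons]
  rw [Gfun_eq_of_mem_pieceT (by
    simp only [pieceT, Set.mem_setOf_eq, Matrix.cons_val_zero, Matrix.cons_val_one, Matrix.cons_val_two,
      Matrix.head_cons, Matrix.tail_cons]
    exact ⟨⟨h0, h1, h2, h3⟩, ⟨h4, h5, h6, h7, h8, h9⟩⟩)]
  simp only [Matrix.cons_val_zero, Matrix.cons_val_one, Matrix.cons_val_two, Matrix.head_cons, Matrix.tail_cons,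
    ev3_qfT_xyz]

/-- On `B_{zyx}` the fibre value is `F↾B(z,y,x)`. [cite: Polymath8b2014, Section 7.4] -/
theorem F3_fibre_B_zyx {x y u : ℝ} (h0 : 0 < y) (h1 : y < u) (h2 : u < x) (h3 : u + y + x < 3/2) (h4 : y + x < 3/4) (h5 : 3/4 < x + u) (h6 : x + u < 5/4) :
    F3 ![x, y, u] = ev3 x y u qfB_zyx := by
  rw [F3_eq_210 (t := ![x, y, u]) (by
    simp only [Matrix.cons_val_zero, Matrix.cons_val_one, Matrix.cons_val_two, Matrix.head_cons, Matrix.tail_cons]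
    exact ⟨h0, h1, h2⟩)]
  simp only [Matrix.cons_val_zero, Matrix.cons_val_one, Matrix.cons_val_two, Matrix.head_cons, Matrix.tail_cons]
  rw [Gfun_eq_of_mem_pieceB (by
    simp only [pieceB, Set.mem_setOf_eq, Matrix.cons_val_zero, Matrix.cons_val_one, Matrix.cons_val_two,
      Matrix.head_cons, Matrix.tail_cons]
    exact ⟨⟨h0, h1, h2, h3⟩, ⟨h4, h5, h6⟩⟩)]
  simp only [Matrix.cons_val_zero, Matrix.cons_val_one, Matrix.cons_val_two, Matrix.head_cons, Matrix.tail_cons,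
    ev3_qfB_zyx]

/-- On `S_{xyz}` the fibre value is `F↾S(x,y,z)`. [cite: Polymath8b2014, Section 7.4] -/
theorem F3_fibre_S_xyz {x y u : ℝ} (h0 : 0 < y) (h1 : y < x) (h2 : x < u) (h3 : x + y + u < 3/2) (h4 : x + y < 3/4) (h5 : 3/4 < y + u) (h6 : y + u < 5/4) (h7 : 5/4 < u + x) (h8 : u < 3/4) :
    F3 ![x, y, u] = ev3 x y u qfS_xyz := by
  rw [F3_eq_012 (t := ![x, y, u]) (by
    simp only [Matrix.cons_val_zero, Matrix.cons_val_one, Matrix.cons_val_two, Matrix.head_cons, Matrix.tail_cons]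
    exact ⟨h0, h1, h2⟩)]
  simp only [Matrix.cons_val_zero, Matrix.cons_val_one, Matrix.cons_val_two, Matrix.head_cons, Matrix.tail_cons]
  rw [Gfun_eq_of_mem_pieceS (by
    simp only [pieceS, Set.mem_setOf_eq, Matrix.cons_val_zero, Matrix.cons_val_one, Matrix.cons_val_two,
      Matrix.head_cons, Matrix.tail_cons]
    exact ⟨⟨h0, h1, h2, h3⟩, ⟨h4, h5, h6, h7, h8⟩⟩)]
  simp only [Matrix.cons_val_zero, Matrix.cons_val_one, Matrix.cons_val_two, Matrix.head_cons, Matrix.tail_cons,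
    ev3_qfS_xyz]

/-- On `E_{xyz}` the fibre value is `F↾E(x,y,z)`. [cite: Polymath8b2014, Section 7.4] -/
theorem F3_fibre_E_xyz {x y u : ℝ} (h0 : 0 < y) (h1 : y < x) (h2 : x < u) (h3 : x + y + u < 3/2) (h4 : y + u < 3/4) (h5 : 5/4 < u + x) :
    F3 ![x, y, u] = ev3 x y u qfE_xyz := by
  rw [F3_eq_012 (t := ![x, y, u]) (by
    simp only [Matrix.cons_val_zero, Matrix.cons_val_one, Matrix.cons_val_two, Matrix.head_cons, Matrix.tail_cons]
    exact ⟨h0, h1, h2⟩)]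
  simp only [Matrix.cons_val_zero, Matrix.cons_val_one, Matrix.cons_val_two, Matrix.head_cons, Matrix.tail_cons]
  rw [Gfun_eq_of_mem_pieceE (by
    simp only [pieceE, Set.mem_setOf_eq, Matrix.cons_val_zero, Matrix.cons_val_one, Matrix.cons_val_two,
      Matrix.head_cons, Matrix.tail_cons]
    exact ⟨⟨h0, h1, h2, h3⟩, ⟨h4, h5⟩⟩)]
  simp only [Matrix.cons_val_zero, Matrix.cons_val_one, Matrix.cons_val_two, Matrix.head_cons, Matrix.tail_cons,
    ev3_qfE_xyz]

/-- On `E_{zyx}` the fibre value is `F↾E(z,y,x)`. [cite: Polymath8b2014, Section 7.4] -/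
theorem F3_fibre_E_zyx {x y u : ℝ} (h0 : 0 < y) (h1 : y < u) (h2 : u < x) (h3 : u + y + x < 3/2) (h4 : y + x < 3/4) (h5 : 5/4 < x + u) :
    F3 ![x, y, u] = ev3 x y u qfE_zyx := by
  rw [F3_eq_210 (t := ![x, y, u]) (by
    simp only [Matrix.cons_val_zero, Matrix.cons_val_one, Matrix.cons_val_two, Matrix.head_cons, Matrix.tail_cons]
    exact ⟨h0, h1, h2⟩)]
  simp only [Matrix.cons_val_zero, Matrix.cons_val_one, Matrix.cons_val_two, Matrix.head_cons, Matrix.tail_cons]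
  rw [Gfun_eq_of_mem_pieceE (by
    simp only [pieceE, Set.mem_setOf_eq, Matrix.cons_val_zero, Matrix.cons_val_one, Matrix.cons_val_two,
      Matrix.head_cons, Matrix.tail_cons]
    exact ⟨⟨h0, h1, h2, h3⟩, ⟨h4, h5⟩⟩)]
  simp only [Matrix.cons_val_zero, Matrix.cons_val_one, Matrix.cons_val_two, Matrix.head_cons, Matrix.tail_cons,
    ev3_qfE_zyx]

/-- On `E_{yzx}` the fibre value is `F↾E(y,z,x)`. [cite: Polymath8b2014, Section 7.4] -/
theorem F3_fibre_E_yzx {x y u : ℝ} (h0 : 0 < u) (h1 : u < y) (h2 : y < x) (h3 : y + u + x < 3/2) (h4 : u + x < 3/4) (h5 : 5/4 < x + y) :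
    F3 ![x, y, u] = ev3 x y u qfE_yzx := by
  rw [F3_eq_120 (t := ![x, y, u]) (by
    simp only [Matrix.cons_val_zero, Matrix.cons_val_one, Matrix.cons_val_two, Matrix.head_cons, Matrix.tail_cons]
    exact ⟨h0, h1, h2⟩)]
  simp only [Matrix.cons_val_zero, Matrix.cons_val_one, Matrix.cons_val_two, Matrix.head_cons, Matrix.tail_cons]
  rw [Gfun_eq_of_mem_pieceE (by
    simp only [pieceE, Set.mem_setOf_eq, Matrix.cons_val_zero, Matrix.cons_val_one, Matrix.cons_val_two,
      Matrix.head_cons, Matrix.tail_cons]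
    exact ⟨⟨h0, h1, h2, h3⟩, ⟨h4, h5⟩⟩)]
  simp only [Matrix.cons_val_zero, Matrix.cons_val_one, Matrix.cons_val_two, Matrix.head_cons, Matrix.tail_cons,
    ev3_qfE_yzx]

/-- On `S_{yzx}` the fibre value is `F↾S(y,z,x)`. [cite: Polymath8b2014, Section 7.4] -/
theorem F3_fibre_S_yzx {x y u : ℝ} (h0 : 0 < u) (h1 : u < y) (h2 : y < x) (h3 : y + u + x < 3/2) (h4 : y + u < 3/4) (h5 : 3/4 < u + x) (h6 : u + x < 5/4) (h7 : 5/4 < x + y) (h8 : x < 3/4) :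
    F3 ![x, y, u] = ev3 x y u qfS_yzx := by
  rw [F3_eq_120 (t := ![x, y, u]) (by
    simp only [Matrix.cons_val_zero, Matrix.cons_val_one, Matrix.cons_val_two, Matrix.head_cons, Matrix.tail_cons]
    exact ⟨h0, h1, h2⟩)]
  simp only [Matrix.cons_val_zero, Matrix.cons_val_one, Matrix.cons_val_two, Matrix.head_cons, Matrix.tail_cons]
  rw [Gfun_eq_of_mem_pieceS (by
    simp only [pieceS, Set.mem_setOf_eq, Matrix.cons_val_zero, Matrix.cons_val_one, Matrix.cons_val_two,
      Matrix.head_cons, Matrix.tail_cons]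
    exact ⟨⟨h0, h1, h2, h3⟩, ⟨h4, h5, h6, h7, h8⟩⟩)]
  simp only [Matrix.cons_val_zero, Matrix.cons_val_one, Matrix.cons_val_two, Matrix.head_cons, Matrix.tail_cons,
    ev3_qfS_yzx]

/-- On `H_{yzx}` the fibre value is `F↾H(y,z,x)`. [cite: Polymath8b2014, Section 7.4] -/
theorem F3_fibre_H_yzx {x y u : ℝ} (h0 : 0 < u) (h1 : u < y) (h2 : y < x) (h3 : y + u + x < 3/2) (h4 : 3/4 < y + u) (h5 : u + x < 5/4) (h6 : 5/4 < x + y) :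
    F3 ![x, y, u] = ev3 x y u qfH_yzx := by
  rw [F3_eq_120 (t := ![x, y, u]) (by
    simp only [Matrix.cons_val_zero, Matrix.cons_val_one, Matrix.cons_val_two, Matrix.head_cons, Matrix.tail_cons]
    exact ⟨h0, h1, h2⟩)]
  simp only [Matrix.cons_val_zero, Matrix.cons_val_one, Matrix.cons_val_two, Matrix.head_cons, Matrix.tail_cons]
  rw [Gfun_eq_of_mem_pieceH (by
    simp only [pieceH, Set.mem_setOf_eq, Matrix.cons_val_zero, Matrix.cons_val_one, Matrix.cons_val_two,
      Matrix.head_cons, Matrix.tail_cons]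
    exact ⟨⟨h0, h1, h2, h3⟩, ⟨h4, h5, h6⟩⟩)]
  simp only [Matrix.cons_val_zero, Matrix.cons_val_one, Matrix.cons_val_two, Matrix.head_cons, Matrix.tail_cons,
    ev3_qfH_yzx]

/-- On `T_{yzx}` the fibre value is `F↾T(y,z,x)`. [cite: Polymath8b2014, Section 7.4] -/
theorem F3_fibre_T_yzx {x y u : ℝ} (h0 : 0 < u) (h1 : u < y) (h2 : y < x) (h3 : y + u + x < 3/2) (h4 : y + u < 3/4) (h5 : 3/4 < u + x) (h6 : u + x < 5/4) (h7 : 5/4 < x + y) (h8 : 3/4 < x) (h9 : 1/4 < y) :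
    F3 ![x, y, u] = ev3 x y u qfT_yzx := by
  rw [F3_eq_120 (t := ![x, y, u]) (by
    simp only [Matrix.cons_val_zero, Matrix.cons_val_one, Matrix.cons_val_two, Matrix.head_cons, Matrix.tail_cons]
    exact ⟨h0, h1, h2⟩)]
  simp only [Matrix.cons_val_zero, Matrix.cons_val_one, Matrix.cons_val_two, Matrix.head_cons, Matrix.tail_cons]
  rw [Gfun_eq_of_mem_pieceT (by
    simp only [pieceT, Set.mem_setOf_eq, Matrix.cons_val_zero, Matrix.cons_val_one, Matrix.cons_val_two,
      Matrix.head_cons, Matrix.tail_cons]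
    exact ⟨⟨h0, h1, h2, h3⟩, ⟨h4, h5, h6, h7, h8, h9⟩⟩)]
  simp only [Matrix.cons_val_zero, Matrix.cons_val_one, Matrix.cons_val_two, Matrix.head_cons, Matrix.tail_cons,
    ev3_qfT_yzx]

/-- On `U_{yzx}` the fibre value is `F↾U(y,z,x)`. [cite: Polymath8b2014, Section 7.4] -/
theorem F3_fibre_U_yzx {x y u : ℝ} (h0 : 0 < u) (h1 : u < y) (h2 : y < x) (h3 : y + u + x < 3/2) (h4 : y + u < 3/4) (h5 : 3/4 < u + x) (h6 : u + x < 5/4) (h7 : 5/4 < x + y) (h8 : y < 1/4) :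
    F3 ![x, y, u] = ev3 x y u qfU_yzx := by
  rw [F3_eq_120 (t := ![x, y, u]) (by
    simp only [Matrix.cons_val_zero, Matrix.cons_val_one, Matrix.cons_val_two, Matrix.head_cons, Matrix.tail_cons]
    exact ⟨h0, h1, h2⟩)]
  simp only [Matrix.cons_val_zero, Matrix.cons_val_one, Matrix.cons_val_two, Matrix.head_cons, Matrix.tail_cons]
  rw [Gfun_eq_of_mem_pieceU (by
    simp only [pieceU, Set.mem_setOf_eq, Matrix.cons_val_zero, Matrix.cons_val_one, Matrix.cons_val_two,
      Matrix.head_cons, Matrix.tail_cons]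
    exact ⟨⟨h0, h1, h2, h3⟩, ⟨h4, h5, h6, h7, h8⟩⟩)]
  simp only [Matrix.cons_val_zero, Matrix.cons_val_one, Matrix.cons_val_two, Matrix.head_cons, Matrix.tail_cons,
    ev3_qfU_yzx]

/-- On `G_{yzx}` the fibre value is `F↾G(y,z,x)`. [cite: Polymath8b2014, Section 7.4] -/
theorem F3_fibre_G_yzx {x y u : ℝ} (h0 : 0 < u) (h1 : u < y) (h2 : y < x) (h3 : y + u + x < 3/2) (h4 : y + u < 3/4) (h5 : 5/4 < u + x) :
    F3 ![x, y, u] = ev3 x y u qfG_yzx := by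
  rw [F3_eq_120 (t := ![x, y, u]) (by
    simp only [Matrix.cons_val_zero, Matrix.cons_val_one, Matrix.cons_val_two, Matrix.head_cons, Matrix.tail_cons]
    exact ⟨h0, h1, h2⟩)]
  simp only [Matrix.cons_val_zero, Matrix.cons_val_one, Matrix.cons_val_two, Matrix.head_cons, Matrix.tail_cons]
  rw [Gfun_eq_of_mem_pieceG (by
    simp only [pieceG, Set.mem_setOf_eq, Matrix.cons_val_zero, Matrix.cons_val_one, Matrix.cons_val_two,
      Matrix.head_cons, Matrix.tail_cons]
    exact ⟨⟨h0, h1, h2, h3⟩, ⟨h4, h5⟩⟩)]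
  simp only [Matrix.cons_val_zero, Matrix.cons_val_one, Matrix.cons_val_two, Matrix.head_cons, Matrix.tail_cons,
    ev3_qfG_yzx]

/-- On `G_{zyx}` the fibre value is `F↾G(z,y,x)`. [cite: Polymath8b2014, Section 7.4] -/
theorem F3_fibre_G_zyx {x y u : ℝ} (h0 : 0 < y) (h1 : y < u) (h2 : u < x) (h3 : u + y + x < 3/2) (h4 : u + y < 3/4) (h5 : 5/4 < y + x) :
    F3 ![x, y, u] = ev3 x y u qfG_zyx := by
  rw [F3_eq_210 (t := ![x, y, u]) (by
    simp only [Matrix.cons_val_zero, Matrix.cons_val_one, Matrix.cons_val_two, Matrix.head_cons, Matrix.tail_cons]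
    exact ⟨h0, h1, h2⟩)]
  simp only [Matrix.cons_val_zero, Matrix.cons_val_one, Matrix.cons_val_two, Matrix.head_cons, Matrix.tail_cons]
  rw [Gfun_eq_of_mem_pieceG (by
    simp only [pieceG, Set.mem_setOf_eq, Matrix.cons_val_zero, Matrix.cons_val_one, Matrix.cons_val_two,
      Matrix.head_cons, Matrix.tail_cons]
    exact ⟨⟨h0, h1, h2, h3⟩, ⟨h4, h5⟩⟩)]
  simp only [Matrix.cons_val_zero, Matrix.cons_val_one, Matrix.cons_val_two, Matrix.head_cons, Matrix.tail_cons,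
    ev3_qfG_zyx]

/-- Beyond the top of the simplex the fibre value vanishes. [cite: Polymath8b2014, Theorem 3.15] -/
theorem F3_fibre_zero {x y u : ℝ} (h : 3 / 2 - x - y < u) : F3 ![x, y, u] = 0 := by
  by_contra hne
  have := (pos_of_F3_ne_zero hne).2
  simp only [Matrix.cons_val_zero, Matrix.cons_val_one, Matrix.cons_val_two, Matrix.head_cons,
    Matrix.tail_cons] at this
  linarith

/-- **The `z`-marginal** `m(x, y) = ∫_{u > 0} F(x, y, u) du` of the cutoff (the inner integral of
`J(F)` in (7.10) and of the vanishing marginal condition (7.8)). [cite: Polymath8b2014, Section 7.4] -/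
def mfun (x y : ℝ) : ℝ := ∫ u in Set.Ioi 0, F3 ![x, y, u]

/-! ### The marginal on each region: the displays `J₁`–`J₈` (p. 33) and (7.12)–(7.17) (p. 34) -/

/-- Breakpoints of the fibre over the region `Q1`. [cite: Polymath8b2014, Section 7.4] -/
def aQ1 (x y : ℝ) : ℕ → ℝ
  | 0 => ((⟨0, 0, 0⟩ : Aff2).val x y)
  | 1 => ((⟨0, 0, 1⟩ : Aff2).val x y)
  | 2 => ((⟨0, 1, 0⟩ : Aff2).val x y)
  | 3 => ((⟨(3/4), (-1), 0⟩ : Aff2).val x y)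
  | 4 => ((⟨(3/4), 0, (-1)⟩ : Aff2).val x y)
  | 5 => ((⟨(5/4), (-1), 0⟩ : Aff2).val x y)
  | 6 => ((⟨(5/4), 0, (-1)⟩ : Aff2).val x y)
  | _ => ((⟨(3/2), (-1), (-1)⟩ : Aff2).val x y)

/-- Pieces of the fibre over the region `Q1`. [cite: Polymath8b2014, Section 7.4] -/
def gQ1 (x y : ℝ) : ℕ → ℝ → ℝ
  | 0 => fun u => ev3 x y u qfA_yzx
  | 1 => fun u => ev3 x y u qfA_zyx
  | 2 => fun u => ev3 x y u qfA_xyz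
  | 3 => fun u => ev3 x y u qfB_xyz
  | 4 => fun u => ev3 x y u qfC_xyz
  | 5 => fun u => ev3 x y u qfU_xyz
  | _ => fun u => ev3 x y u qfG_xyz

/-- **The marginal polynomial on `Q1`** (a `Q2` term: the sum of the exact integrals of the pieces
between consecutive breakpoints). [cite: Polymath8b2014, Section 7.4] -/
def MQ1 : Q2 :=
  (ops2.add (ops2.add (ops2.add (ops2.add (ops2.add (ops2.add (ops2.lint qfA_yzx (⟨0, 0, 0⟩ : Aff2).toQ2 (⟨0, 0, 1⟩ : Aff2).toQ2) (ops2.lint qfA_zyx (⟨0, 0, 1⟩ : Aff2).toQ2 (⟨0, 1, 0⟩ : Aff2).toQ2)) (ops2.lint qfA_xyz (⟨0, 1, 0⟩ : Aff2).toQ2 (⟨(3/4), (-1), 0⟩ : Aff2).toQ2)) (ops2.lint qfB_xyz (⟨(3/4), (-1), 0⟩ : Aff2).toQ2 (⟨(3/4), 0, (-1)⟩ : Aff2).toQ2)) (ops2.lint qfC_xyz (⟨(3/4), 0, (-1)⟩ : Aff2).toQ2 (⟨(5/4), (-1), 0⟩ : Aff2).toQ2)) (ops2.lint qfU_xyz (⟨(5/4),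 (-1), 0⟩ : Aff2).toQ2 (⟨(5/4), 0, (-1)⟩ : Aff2).toQ2)) (ops2.lint qfG_xyz (⟨(5/4), 0, (-1)⟩ : Aff2).toQ2 (⟨(3/2), (-1), (-1)⟩ : Aff2).toQ2))


/-- **The fibre structure over `Q1`**: for `(x, y)` in the open region, `m(x,y) = MQ1(x,y)`, the
fibre meeting `A_{yzx}` on `(0, y)`, `A_{zyx}` on `(y, x)`, `A_{xyz}` on `(x, 3/4 - x)`, `B_{xyz}` on `(3/4 - x, 3/4 - y)`, `C_{xyz}` on `(3/4 - y, 5/4 - x)`, `U_{xyz}` on `(5/4 - x, 5/4 - y)`, `G_{xyz}` on `(5/4 - y, 3/2 - x - y)`. [cite: Polymath8b2014, Section 7.4] -/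
theorem mfun_Q1 {x y : ℝ} (_r0 : 0 < x) (_r1 : 0 < 1/4 - x) (_r2 : 0 < y) (_r3 : 0 < x - y) :
    mfun x y = ev2 x y MQ1 := by
  have key := setIntegral_Ioi_eq_sum_of_piecewise (integrable_fibre x y) (n := 7) (aQ1 x y) (gQ1 x y)
    (by simp [aQ1, Aff2.val]) ?_ ?_ ?_
  · rw [mfun, key]
    simp only [Finset.sum_range_succ, Finset.sum_range_zero, zero_add, aQ1, gQ1]
    rw [MQ1]
    rw [(lawful2 x y).add, (lawful2 x y).add, (lawful2 x y).add, (lawful2 x y).add, (lawful2 x y).add, (lawful2 x y).add]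
    rw [← integral_leval (lawful2 x y) qfA_yzx, ← integral_leval (lawful2 x y) qfA_zyx, ← integral_leval (lawful2 x y) qfA_xyz, ← integral_leval (lawful2 x y) qfB_xyz, ← integral_leval (lawful2 x y) qfC_xyz, ← integral_leval (lawful2 x y) qfU_xyz, ← integral_leval (lawful2 x y) qfG_xyz]
    simp only [Aff2.ev2_toQ2]
    rfl
  · intro k hk
    interval_cases k <;> simp only [aQ1, Aff2.val] <;> push_cast <;> linarith
  · intro k hk u hu
    interval_cases k
    · simp only [aQ1, Aff2.val, Set.mem_Ioo] at hu
      push_cast at hu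
      obtain ⟨hu1, hu2⟩ := hu
      simp only [gQ1]
      exact F3_fibre_A_yzx (by linarith) (by linarith) (by linarith) (by linarith) (by linarith)
    · simp only [aQ1, Aff2.val, Set.mem_Ioo] at hu
      push_cast at hu
      obtain ⟨hu1, hu2⟩ := hu
      simp only [gQ1]
      exact F3_fibre_A_zyx (by linarith) (by linarith) (by linarith) (by linarith) (by linarith)
    · simp only [aQ1, Aff2.val, Set.mem_Ioo] at hu
      push_cast at hu
      obtain ⟨hu1, hu2⟩ := hu
      simp only [gQ1]
      exact F3_fibre_A_xyz (by linarith) (by linarith) (by linarith) (by linarith) (by linarith)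
    · simp only [aQ1, Aff2.val, Set.mem_Ioo] at hu
      push_cast at hu
      obtain ⟨hu1, hu2⟩ := hu
      simp only [gQ1]
      exact F3_fibre_B_xyz (by linarith) (by linarith) (by linarith) (by linarith) (by linarith) (by linarith) (by linarith)
    · simp only [aQ1, Aff2.val, Set.mem_Ioo] at hu
      push_cast at hu
      obtain ⟨hu1, hu2⟩ := hu
      simp only [gQ1]
      exact F3_fibre_C_xyz (by linarith) (by linarith) (by linarith) (by linarith) (by linarith) (by linarith) (by linarith)
    · simp only [aQ1, Aff2.val, Set.mem_Ioo] at hu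
      push_cast at hu
      obtain ⟨hu1, hu2⟩ := hu
      simp only [gQ1]
      exact F3_fibre_U_xyz (by linarith) (by linarith) (by linarith) (by linarith) (by linarith) (by linarith) (by linarith) (by linarith) (by linarith)
    · simp only [aQ1, Aff2.val, Set.mem_Ioo] at hu
      push_cast at hu
      obtain ⟨hu1, hu2⟩ := hu
      simp only [gQ1]
      exact F3_fibre_G_xyz (by linarith) (by linarith) (by linarith) (by linarith) (by linarith) (by linarith)
  · intro u hu
    simp only [aQ1, Aff2.val] at hu
    push_cast at hu
    exact F3_fibre_zero (by linarith)

/-- Breakpoints of the fibre over the region `Q2`. [cite: Polymath8b2014, Section 7.4] -/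
def aQ2 (x y : ℝ) : ℕ → ℝ
  | 0 => ((⟨0, 0, 0⟩ : Aff2).val x y)
  | 1 => ((⟨0, 0, 1⟩ : Aff2).val x y)
  | 2 => ((⟨0, 1, 0⟩ : Aff2).val x y)
  | 3 => ((⟨(3/4), (-1), 0⟩ : Aff2).val x y)
  | 4 => ((⟨(3/4), 0, (-1)⟩ : Aff2).val x y)
  | _ => ((⟨(3/2), (-1), (-1)⟩ : Aff2).val x y)

/-- Pieces of the fibre over the region `Q2`. [cite: Polymath8b2014, Section 7.4] -/
def gQ2 (x y : ℝ) : ℕ → ℝ → ℝ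
  | 0 => fun u => ev3 x y u qfA_yzx
  | 1 => fun u => ev3 x y u qfA_zyx
  | 2 => fun u => ev3 x y u qfA_xyz
  | 3 => fun u => ev3 x y u qfB_xyz
  | _ => fun u => ev3 x y u qfC_xyz

/-- **The marginal polynomial on `Q2`** (a `Q2` term: the sum of the exact integrals of the pieces
between consecutive breakpoints). [cite: Polymath8b2014, Section 7.4] -/
def MQ2 : Q2 :=
  (ops2.add (ops2.add (ops2.add (ops2.add (ops2.lint qfA_yzx (⟨0, 0, 0⟩ : Aff2).toQ2 (⟨0, 0, 1⟩ : Aff2).toQ2) (ops2.lint qfA_zyx (⟨0, 0, 1⟩ : Aff2).toQ2 (⟨0, 1, 0⟩ : Aff2).toQ2)) (ops2.lint qfA_xyz (⟨0, 1, 0⟩ : Aff2).toQ2 (⟨(3/4), (-1), 0⟩ : Aff2).toQ2)) (ops2.lint qfB_xyz (⟨(3/4), (-1), 0⟩ : Aff2).toQ2 (⟨(3/4), 0, (-1)⟩ : Aff2).toQ2)) (ops2.lint qfC_xyz (⟨(3/4), 0, (-1)⟩ : Aff2).toQ2 (⟨(3/2), (-1), (-1)⟩ : Aff2).toQ2))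


/-- **The fibre structure over `Q2`**: for `(x, y)` in the open region, `m(x,y) = MQ2(x,y)`, the
fibre meeting `A_{yzx}` on `(0, y)`, `A_{zyx}` on `(y, x)`, `A_{xyz}` on `(x, 3/4 - x)`, `B_{xyz}` on `(3/4 - x, 3/4 - y)`, `C_{xyz}` on `(3/4 - y, 3/2 - x - y)`. [cite: Polymath8b2014, Section 7.4] -/
theorem mfun_Q2 {x y : ℝ} (_r0 : 0 < x - 1/4) (_r1 : 0 < 3/8 - x) (_r2 : 0 < y - 1/4) (_r3 : 0 < x - y) :
    mfun x y = ev2 x y MQ2 := by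
  have key := setIntegral_Ioi_eq_sum_of_piecewise (integrable_fibre x y) (n := 5) (aQ2 x y) (gQ2 x y)
    (by simp [aQ2, Aff2.val]) ?_ ?_ ?_
  · rw [mfun, key]
    simp only [Finset.sum_range_succ, Finset.sum_range_zero, zero_add, aQ2, gQ2]
    rw [MQ2]
    rw [(lawful2 x y).add, (lawful2 x y).add, (lawful2 x y).add, (lawful2 x y).add]
    rw [← integral_leval (lawful2 x y) qfA_yzx, ← integral_leval (lawful2 x y) qfA_zyx, ← integral_leval (lawful2 x y) qfA_xyz, ← integral_leval (lawful2 x y) qfB_xyz, ← integral_leval (lawful2 x y) qfC_xyz]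
    simp only [Aff2.ev2_toQ2]
    rfl
  · intro k hk
    interval_cases k <;> simp only [aQ2, Aff2.val] <;> push_cast <;> linarith
  · intro k hk u hu
    interval_cases k
    · simp only [aQ2, Aff2.val, Set.mem_Ioo] at hu
      push_cast at hu
      obtain ⟨hu1, hu2⟩ := hu
      simp only [gQ2]
      exact F3_fibre_A_yzx (by linarith) (by linarith) (by linarith) (by linarith) (by linarith)
    · simp only [aQ2, Aff2.val, Set.mem_Ioo] at hu
      push_cast at hu
      obtain ⟨hu1, hu2⟩ := hu
      simp only [gQ2]
      exact F3_fibre_A_zyx (by linarith) (by linarith) (by linarith) (by linarith) (by linarith)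
    · simp only [aQ2, Aff2.val, Set.mem_Ioo] at hu
      push_cast at hu
      obtain ⟨hu1, hu2⟩ := hu
      simp only [gQ2]
      exact F3_fibre_A_xyz (by linarith) (by linarith) (by linarith) (by linarith) (by linarith)
    · simp only [aQ2, Aff2.val, Set.mem_Ioo] at hu
      push_cast at hu
      obtain ⟨hu1, hu2⟩ := hu
      simp only [gQ2]
      exact F3_fibre_B_xyz (by linarith) (by linarith) (by linarith) (by linarith) (by linarith) (by linarith) (by linarith)
    · simp only [aQ2, Aff2.val, Set.mem_Ioo] at hu
      push_cast at hu
      obtain ⟨hu1, hu2⟩ := hu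
      simp only [gQ2]
      exact F3_fibre_C_xyz (by linarith) (by linarith) (by linarith) (by linarith) (by linarith) (by linarith) (by linarith)
  · intro u hu
    simp only [aQ2, Aff2.val] at hu
    push_cast at hu
    exact F3_fibre_zero (by linarith)

/-- Breakpoints of the fibre over the region `Q3`. [cite: Polymath8b2014, Section 7.4] -/
def aQ3 (x y : ℝ) : ℕ → ℝ
  | 0 => ((⟨0, 0, 0⟩ : Aff2).val x y)
  | 1 => ((⟨0, 0, 1⟩ : Aff2).val x y)
  | 2 => ((⟨0, 1, 0⟩ : Aff2).val x y)
  | 3 => ((⟨(3/4), (-1), 0⟩ : Aff2).val x y)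
  | 4 => ((⟨(3/4), 0, (-1)⟩ : Aff2).val x y)
  | 5 => ((⟨(5/4), (-1), 0⟩ : Aff2).val x y)
  | _ => ((⟨(3/2), (-1), (-1)⟩ : Aff2).val x y)

/-- Pieces of the fibre over the region `Q3`. [cite: Polymath8b2014, Section 7.4] -/
def gQ3 (x y : ℝ) : ℕ → ℝ → ℝ
  | 0 => fun u => ev3 x y u qfA_yzx
  | 1 => fun u => ev3 x y u qfA_zyx
  | 2 => fun u => ev3 x y u qfA_xyz
  | 3 => fun u => ev3 x y u qfB_xyz
  | 4 => fun u => ev3 x y u qfC_xyz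
  | _ => fun u => ev3 x y u qfT_xyz

/-- **The marginal polynomial on `Q3`** (a `Q2` term: the sum of the exact integrals of the pieces
between consecutive breakpoints). [cite: Polymath8b2014, Section 7.4] -/
def MQ3 : Q2 :=
  (ops2.add (ops2.add (ops2.add (ops2.add (ops2.add (ops2.lint qfA_yzx (⟨0, 0, 0⟩ : Aff2).toQ2 (⟨0, 0, 1⟩ : Aff2).toQ2) (ops2.lint qfA_zyx (⟨0, 0, 1⟩ : Aff2).toQ2 (⟨0, 1, 0⟩ : Aff2).toQ2)) (ops2.lint qfA_xyz (⟨0, 1, 0⟩ : Aff2).toQ2 (⟨(3/4), (-1), 0⟩ : Aff2).toQ2)) (ops2.lint qfB_xyz (⟨(3/4), (-1), 0⟩ : Aff2).toQ2 (⟨(3/4), 0, (-1)⟩ : Aff2).toQ2)) (ops2.lint qfC_xyz (⟨(3/4), 0, (-1)⟩ : Aff2).toQ2 (⟨(5/4), (-1), 0⟩ : Aff2).toQ2)) (ops2.lint qfT_xyz (⟨(5/4), (-1), 0⟩ : Aff2).toQ2 (⟨(3/2), (-1), (-1)⟩ : Aff2).toQ2))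


/-- **The fibre structure over `Q3`**: for `(x, y)` in the open region, `m(x,y) = MQ3(x,y)`, the
fibre meeting `A_{yzx}` on `(0, y)`, `A_{zyx}` on `(y, x)`, `A_{xyz}` on `(x, 3/4 - x)`, `B_{xyz}` on `(3/4 - x, 3/4 - y)`, `C_{xyz}` on `(3/4 - y, 5/4 - x)`, `T_{xyz}` on `(5/4 - x, 3/2 - x - y)`. [cite: Polymath8b2014, Section 7.4] -/
theorem mfun_Q3 {x y : ℝ} (_r0 : 0 < x - 1/4) (_r1 : 0 < 3/8 - x) (_r2 : 0 < y) (_r3 : 0 < 1/4 - y) :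
    mfun x y = ev2 x y MQ3 := by
  have key := setIntegral_Ioi_eq_sum_of_piecewise (integrable_fibre x y) (n := 6) (aQ3 x y) (gQ3 x y)
    (by simp [aQ3, Aff2.val]) ?_ ?_ ?_
  · rw [mfun, key]
    simp only [Finset.sum_range_succ, Finset.sum_range_zero, zero_add, aQ3, gQ3]
    rw [MQ3]
    rw [(lawful2 x y).add, (lawful2 x y).add, (lawful2 x y).add, (lawful2 x y).add, (lawful2 x y).add]
    rw [← integral_leval (lawful2 x y) qfA_yzx, ← integral_leval (lawful2 x y) qfA_zyx, ← integral_leval (lawful2 x y) qfA_xyz, ← integral_leval (lawful2 x y) qfB_xyz, ← integral_leval (lawful2 x y) qfC_xyz, ← integral_leval (lawful2 x y) qfT_xyz]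
    simp only [Aff2.ev2_toQ2]
    rfl
  · intro k hk
    interval_cases k <;> simp only [aQ3, Aff2.val] <;> push_cast <;> linarith
  · intro k hk u hu
    interval_cases k
    · simp only [aQ3, Aff2.val, Set.mem_Ioo] at hu
      push_cast at hu
      obtain ⟨hu1, hu2⟩ := hu
      simp only [gQ3]
      exact F3_fibre_A_yzx (by linarith) (by linarith) (by linarith) (by linarith) (by linarith)
    · simp only [aQ3, Aff2.val, Set.mem_Ioo] at hu
      push_cast at hu
      obtain ⟨hu1, hu2⟩ := hu
      simp only [gQ3]
      exact F3_fibre_A_zyx (by linarith) (by linarith) (by linarith) (by linarith) (by linarith)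
    · simp only [aQ3, Aff2.val, Set.mem_Ioo] at hu
      push_cast at hu
      obtain ⟨hu1, hu2⟩ := hu
      simp only [gQ3]
      exact F3_fibre_A_xyz (by linarith) (by linarith) (by linarith) (by linarith) (by linarith)
    · simp only [aQ3, Aff2.val, Set.mem_Ioo] at hu
      push_cast at hu
      obtain ⟨hu1, hu2⟩ := hu
      simp only [gQ3]
      exact F3_fibre_B_xyz (by linarith) (by linarith) (by linarith) (by linarith) (by linarith) (by linarith) (by linarith)
    · simp only [aQ3, Aff2.val, Set.mem_Ioo] at hu
      push_cast at hu
      obtain ⟨hu1, hu2⟩ := hu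
      simp only [gQ3]
      exact F3_fibre_C_xyz (by linarith) (by linarith) (by linarith) (by linarith) (by linarith) (by linarith) (by linarith)
    · simp only [aQ3, Aff2.val, Set.mem_Ioo] at hu
      push_cast at hu
      obtain ⟨hu1, hu2⟩ := hu
      simp only [gQ3]
      exact F3_fibre_T_xyz (by linarith) (by linarith) (by linarith) (by linarith) (by linarith) (by linarith) (by linarith) (by linarith) (by linarith) (by linarith)
  · intro u hu
    simp only [aQ3, Aff2.val] at hu
    push_cast at hu
    exact F3_fibre_zero (by linarith)

/-- Breakpoints of the fibre over the region `Q4`. [cite: Polymath8b2014, Section 7.4] -/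
def aQ4 (x y : ℝ) : ℕ → ℝ
  | 0 => ((⟨0, 0, 0⟩ : Aff2).val x y)
  | 1 => ((⟨0, 0, 1⟩ : Aff2).val x y)
  | 2 => ((⟨(3/4), (-1), 0⟩ : Aff2).val x y)
  | 3 => ((⟨0, 1, 0⟩ : Aff2).val x y)
  | 4 => ((⟨(3/4), 0, (-1)⟩ : Aff2).val x y)
  | _ => ((⟨(3/2), (-1), (-1)⟩ : Aff2).val x y)

/-- Pieces of the fibre over the region `Q4`. [cite: Polymath8b2014, Section 7.4] -/
def gQ4 (x y : ℝ) : ℕ → ℝ → ℝ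
  | 0 => fun u => ev3 x y u qfA_yzx
  | 1 => fun u => ev3 x y u qfA_zyx
  | 2 => fun u => ev3 x y u qfB_zyx
  | 3 => fun u => ev3 x y u qfB_xyz
  | _ => fun u => ev3 x y u qfC_xyz

/-- **The marginal polynomial on `Q4`** (a `Q2` term: the sum of the exact integrals of the pieces
between consecutive breakpoints). [cite: Polymath8b2014, Section 7.4] -/
def MQ4 : Q2 :=
  (ops2.add (ops2.add (ops2.add (ops2.add (ops2.lint qfA_yzx (⟨0, 0, 0⟩ : Aff2).toQ2 (⟨0, 0, 1⟩ : Aff2).toQ2) (ops2.lint qfA_zyx (⟨0, 0, 1⟩ : Aff2).toQ2 (⟨(3/4), (-1), 0⟩ : Aff2).toQ2)) (ops2.lint qfB_zyx (⟨(3/4), (-1), 0⟩ : Aff2).toQ2 (⟨0, 1, 0⟩ : Aff2).toQ2)) (ops2.lint qfB_xyz (⟨0, 1, 0⟩ : Aff2).toQ2 (⟨(3/4), 0, (-1)⟩ : Aff2).toQ2)) (ops2.lint qfC_xyz (⟨(3/4), 0, (-1)⟩ : Aff2).toQ2 (⟨(3/2), (-1), (-1)⟩ : Aff2).toQ2))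


/-- **The fibre structure over `Q4`**: for `(x, y)` in the open region, `m(x,y) = MQ4(x,y)`, the
fibre meeting `A_{yzx}` on `(0, y)`, `A_{zyx}` on `(y, 3/4 - x)`, `B_{zyx}` on `(3/4 - x, x)`, `B_{xyz}` on `(x, 3/4 - y)`, `C_{xyz}` on `(3/4 - y, 3/2 - x - y)`. [cite: Polymath8b2014, Section 7.4] -/
theorem mfun_Q4 {x y : ℝ} (_r0 : 0 < x - 3/8) (_r1 : 0 < 1/2 - x) (_r2 : 0 < y - 1/4) (_r3 : 0 < 3/4 - x - y) :
    mfun x y = ev2 x y MQ4 := by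
  have key := setIntegral_Ioi_eq_sum_of_piecewise (integrable_fibre x y) (n := 5) (aQ4 x y) (gQ4 x y)
    (by simp [aQ4, Aff2.val]) ?_ ?_ ?_
  · rw [mfun, key]
    simp only [Finset.sum_range_succ, Finset.sum_range_zero, zero_add, aQ4, gQ4]
    rw [MQ4]
    rw [(lawful2 x y).add, (lawful2 x y).add, (lawful2 x y).add, (lawful2 x y).add]
    rw [← integral_leval (lawful2 x y) qfA_yzx, ← integral_leval (lawful2 x y) qfA_zyx, ← integral_leval (lawful2 x y) qfB_zyx, ← integral_leval (lawful2 x y) qfB_xyz, ← integral_leval (lawful2 x y) qfC_xyz]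
    simp only [Aff2.ev2_toQ2]
    rfl
  · intro k hk
    interval_cases k <;> simp only [aQ4, Aff2.val] <;> push_cast <;> linarith
  · intro k hk u hu
    interval_cases k
    · simp only [aQ4, Aff2.val, Set.mem_Ioo] at hu
      push_cast at hu
      obtain ⟨hu1, hu2⟩ := hu
      simp only [gQ4]
      exact F3_fibre_A_yzx (by linarith) (by linarith) (by linarith) (by linarith) (by linarith)
    · simp only [aQ4, Aff2.val, Set.mem_Ioo] at hu
      push_cast at hu
      obtain ⟨hu1, hu2⟩ := hu
      simp only [gQ4]
      exact F3_fibre_A_zyx (by linarith) (by linarith) (by linarith) (by linarith) (by linarith)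
    · simp only [aQ4, Aff2.val, Set.mem_Ioo] at hu
      push_cast at hu
      obtain ⟨hu1, hu2⟩ := hu
      simp only [gQ4]
      exact F3_fibre_B_zyx (by linarith) (by linarith) (by linarith) (by linarith) (by linarith) (by linarith) (by linarith)
    · simp only [aQ4, Aff2.val, Set.mem_Ioo] at hu
      push_cast at hu
      obtain ⟨hu1, hu2⟩ := hu
      simp only [gQ4]
      exact F3_fibre_B_xyz (by linarith) (by linarith) (by linarith) (by linarith) (by linarith) (by linarith) (by linarith)
    · simp only [aQ4, Aff2.val, Set.mem_Ioo] at hu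
      push_cast at hu
      obtain ⟨hu1, hu2⟩ := hu
      simp only [gQ4]
      exact F3_fibre_C_xyz (by linarith) (by linarith) (by linarith) (by linarith) (by linarith) (by linarith) (by linarith)
  · intro u hu
    simp only [aQ4, Aff2.val] at hu
    push_cast at hu
    exact F3_fibre_zero (by linarith)

/-- Breakpoints of the fibre over the region `Q5`. [cite: Polymath8b2014, Section 7.4] -/
def aQ5 (x y : ℝ) : ℕ → ℝ
  | 0 => ((⟨0, 0, 0⟩ : Aff2).val x y)
  | 1 => ((⟨0, 0, 1⟩ : Aff2).val x y)
  | 2 => ((⟨(3/4), (-1), 0⟩ : Aff2).val x y)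
  | 3 => ((⟨0, 1, 0⟩ : Aff2).val x y)
  | 4 => ((⟨(3/4), 0, (-1)⟩ : Aff2).val x y)
  | 5 => ((⟨(5/4), (-1), 0⟩ : Aff2).val x y)
  | _ => ((⟨(3/2), (-1), (-1)⟩ : Aff2).val x y)

/-- Pieces of the fibre over the region `Q5`. [cite: Polymath8b2014, Section 7.4] -/
def gQ5 (x y : ℝ) : ℕ → ℝ → ℝ
  | 0 => fun u => ev3 x y u qfA_yzx
  | 1 => fun u => ev3 x y u qfA_zyx
  | 2 => fun u => ev3 x y u qfB_zyx
  | 3 => fun u => ev3 x y u qfB_xyz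
  | 4 => fun u => ev3 x y u qfC_xyz
  | _ => fun u => ev3 x y u qfT_xyz

/-- **The marginal polynomial on `Q5`** (a `Q2` term: the sum of the exact integrals of the pieces
between consecutive breakpoints). [cite: Polymath8b2014, Section 7.4] -/
def MQ5 : Q2 :=
  (ops2.add (ops2.add (ops2.add (ops2.add (ops2.add (ops2.lint qfA_yzx (⟨0, 0, 0⟩ : Aff2).toQ2 (⟨0, 0, 1⟩ : Aff2).toQ2) (ops2.lint qfA_zyx (⟨0, 0, 1⟩ : Aff2).toQ2 (⟨(3/4), (-1), 0⟩ : Aff2).toQ2)) (ops2.lint qfB_zyx (⟨(3/4), (-1), 0⟩ : Aff2).toQ2 (⟨0, 1, 0⟩ : Aff2).toQ2)) (ops2.lint qfB_xyz (⟨0, 1, 0⟩ : Aff2).toQ2 (⟨(3/4), 0, (-1)⟩ : Aff2).toQ2)) (ops2.lint qfC_xyz (⟨(3/4), 0, (-1)⟩ : Aff2).toQ2 (⟨(5/4), (-1), 0⟩ : Aff2).toQ2)) (ops2.lint qfT_xyz (⟨(5/4), (-1), 0⟩ : Aff2).toQ2 (⟨(3/2), (-1), (-1)⟩ : Aff2)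.toQ2))


/-- **The fibre structure over `Q5`**: for `(x, y)` in the open region, `m(x,y) = MQ5(x,y)`, the
fibre meeting `A_{yzx}` on `(0, y)`, `A_{zyx}` on `(y, 3/4 - x)`, `B_{zyx}` on `(3/4 - x, x)`, `B_{xyz}` on `(x, 3/4 - y)`, `C_{xyz}` on `(3/4 - y, 5/4 - x)`, `T_{xyz}` on `(5/4 - x, 3/2 - x - y)`. [cite: Polymath8b2014, Section 7.4] -/
theorem mfun_Q5 {x y : ℝ} (_r0 : 0 < x - 3/8) (_r1 : 0 < 1/2 - x) (_r2 : 0 < y) (_r3 : 0 < 1/4 - y) :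
    mfun x y = ev2 x y MQ5 := by
  have key := setIntegral_Ioi_eq_sum_of_piecewise (integrable_fibre x y) (n := 6) (aQ5 x y) (gQ5 x y)
    (by simp [aQ5, Aff2.val]) ?_ ?_ ?_
  · rw [mfun, key]
    simp only [Finset.sum_range_succ, Finset.sum_range_zero, zero_add, aQ5, gQ5]
    rw [MQ5]
    rw [(lawful2 x y).add, (lawful2 x y).add, (lawful2 x y).add, (lawful2 x y).add, (lawful2 x y).add]
    rw [← integral_leval (lawful2 x y) qfA_yzx, ← integral_leval (lawful2 x y) qfA_zyx, ← integral_leval (lawful2 x y) qfB_zyx, ← integral_leval (lawful2 x y) qfB_xyz, ← integral_leval (lawful2 x y) qfC_xyz, ← integral_leval (lawful2 x y) qfT_xyz]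
    simp only [Aff2.ev2_toQ2]
    rfl
  · intro k hk
    interval_cases k <;> simp only [aQ5, Aff2.val] <;> push_cast <;> linarith
  · intro k hk u hu
    interval_cases k
    · simp only [aQ5, Aff2.val, Set.mem_Ioo] at hu
      push_cast at hu
      obtain ⟨hu1, hu2⟩ := hu
      simp only [gQ5]
      exact F3_fibre_A_yzx (by linarith) (by linarith) (by linarith) (by linarith) (by linarith)
    · simp only [aQ5, Aff2.val, Set.mem_Ioo] at hu
      push_cast at hu
      obtain ⟨hu1, hu2⟩ := hu
      simp only [gQ5]
      exact F3_fibre_A_zyx (by linarith) (by linarith) (by linarith) (by linarith) (by linarith)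
    · simp only [aQ5, Aff2.val, Set.mem_Ioo] at hu
      push_cast at hu
      obtain ⟨hu1, hu2⟩ := hu
      simp only [gQ5]
      exact F3_fibre_B_zyx (by linarith) (by linarith) (by linarith) (by linarith) (by linarith) (by linarith) (by linarith)
    · simp only [aQ5, Aff2.val, Set.mem_Ioo] at hu
      push_cast at hu
      obtain ⟨hu1, hu2⟩ := hu
      simp only [gQ5]
      exact F3_fibre_B_xyz (by linarith) (by linarith) (by linarith) (by linarith) (by linarith) (by linarith) (by linarith)
    · simp only [aQ5, Aff2.val, Set.mem_Ioo] at hu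
      push_cast at hu
      obtain ⟨hu1, hu2⟩ := hu
      simp only [gQ5]
      exact F3_fibre_C_xyz (by linarith) (by linarith) (by linarith) (by linarith) (by linarith) (by linarith) (by linarith)
    · simp only [aQ5, Aff2.val, Set.mem_Ioo] at hu
      push_cast at hu
      obtain ⟨hu1, hu2⟩ := hu
      simp only [gQ5]
      exact F3_fibre_T_xyz (by linarith) (by linarith) (by linarith) (by linarith) (by linarith) (by linarith) (by linarith) (by linarith) (by linarith) (by linarith)
  · intro u hu
    simp only [aQ5, Aff2.val] at hu
    push_cast at hu
    exact F3_fibre_zero (by linarith)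

/-- Breakpoints of the fibre over the region `Q6`. [cite: Polymath8b2014, Section 7.4] -/
def aQ6 (x y : ℝ) : ℕ → ℝ
  | 0 => ((⟨0, 0, 0⟩ : Aff2).val x y)
  | 1 => ((⟨0, 0, 1⟩ : Aff2).val x y)
  | 2 => ((⟨(3/4), (-1), 0⟩ : Aff2).val x y)
  | 3 => ((⟨0, 1, 0⟩ : Aff2).val x y)
  | 4 => ((⟨(3/4), 0, (-1)⟩ : Aff2).val x y)
  | 5 => ((⟨(5/4), (-1), 0⟩ : Aff2).val x y)
  | 6 => ((⟨(3/4), 0, 0⟩ : Aff2).val x y)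
  | _ => ((⟨(3/2), (-1), (-1)⟩ : Aff2).val x y)

/-- Pieces of the fibre over the region `Q6`. [cite: Polymath8b2014, Section 7.4] -/
def gQ6 (x y : ℝ) : ℕ → ℝ → ℝ
  | 0 => fun u => ev3 x y u qfA_yzx
  | 1 => fun u => ev3 x y u qfA_zyx
  | 2 => fun u => ev3 x y u qfB_zyx
  | 3 => fun u => ev3 x y u qfB_xyz
  | 4 => fun u => ev3 x y u qfC_xyz
  | 5 => fun u => ev3 x y u qfS_xyz
  | _ => fun u => ev3 x y u qfT_xyz

/-- **The marginal polynomial on `Q6`** (a `Q2` term: the sum of the exact integrals of the pieces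
between consecutive breakpoints). [cite: Polymath8b2014, Section 7.4] -/
def MQ6 : Q2 :=
  (ops2.add (ops2.add (ops2.add (ops2.add (ops2.add (ops2.add (ops2.lint qfA_yzx (⟨0, 0, 0⟩ : Aff2).toQ2 (⟨0, 0, 1⟩ : Aff2).toQ2) (ops2.lint qfA_zyx (⟨0, 0, 1⟩ : Aff2).toQ2 (⟨(3/4), (-1), 0⟩ : Aff2).toQ2)) (ops2.lint qfB_zyx (⟨(3/4), (-1), 0⟩ : Aff2).toQ2 (⟨0, 1, 0⟩ : Aff2).toQ2)) (ops2.lint qfB_xyz (⟨0, 1, 0⟩ : Aff2).toQ2 (⟨(3/4), 0, (-1)⟩ : Aff2).toQ2)) (ops2.lint qfC_xyz (⟨(3/4), 0, (-1)⟩ : Aff2).toQ2 (⟨(5/4), (-1), 0⟩ : Aff2).toQ2)) (ops2.lint qfS_xyz (⟨(5/4), (-1), 0⟩ : Aff2).toQ2 (⟨(3/4), 0, 0⟩ : Aff2).toQ2)) (ops2.lint qfT_xyz (⟨(3/4), 0, 0⟩ : Aff2).toQ2 (⟨(3/2), (-1), (-1)⟩ : Aff2).toQ2))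


/-- **The fibre structure over `Q6`**: for `(x, y)` in the open region, `m(x,y) = MQ6(x,y)`, the
fibre meeting `A_{yzx}` on `(0, y)`, `A_{zyx}` on `(y, 3/4 - x)`, `B_{zyx}` on `(3/4 - x, x)`, `B_{xyz}` on `(x, 3/4 - y)`, `C_{xyz}` on `(3/4 - y, 5/4 - x)`, `S_{xyz}` on `(5/4 - x, 3/4)`, `T_{xyz}` on `(3/4, 3/2 - x - y)`. [cite: Polymath8b2014, Section 7.4] -/
theorem mfun_Q6 {x y : ℝ} (_r0 : 0 < x - 1/2) (_r1 : 0 < 5/8 - x) (_r2 : 0 < y + 1/2 - x) (_r3 : 0 < 3/4 - x - y) :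
    mfun x y = ev2 x y MQ6 := by
  have key := setIntegral_Ioi_eq_sum_of_piecewise (integrable_fibre x y) (n := 7) (aQ6 x y) (gQ6 x y)
    (by simp [aQ6, Aff2.val]) ?_ ?_ ?_
  · rw [mfun, key]
    simp only [Finset.sum_range_succ, Finset.sum_range_zero, zero_add, aQ6, gQ6]
    rw [MQ6]
    rw [(lawful2 x y).add, (lawful2 x y).add, (lawful2 x y).add, (lawful2 x y).add, (lawful2 x y).add, (lawful2 x y).add]
    rw [← integral_leval (lawful2 x y) qfA_yzx, ← integral_leval (lawful2 x y) qfA_zyx, ← integral_leval (lawful2 x y) qfB_zyx, ← integral_leval (lawful2 x y) qfB_xyz, ← integral_leval (lawful2 x y) qfC_xyz, ← integral_leval (lawful2 x y) qfS_xyz, ← integral_leval (lawful2 x y) qfT_xyz]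
    simp only [Aff2.ev2_toQ2]
    rfl
  · intro k hk
    interval_cases k <;> simp only [aQ6, Aff2.val] <;> push_cast <;> linarith
  · intro k hk u hu
    interval_cases k
    · simp only [aQ6, Aff2.val, Set.mem_Ioo] at hu
      push_cast at hu
      obtain ⟨hu1, hu2⟩ := hu
      simp only [gQ6]
      exact F3_fibre_A_yzx (by linarith) (by linarith) (by linarith) (by linarith) (by linarith)
    · simp only [aQ6, Aff2.val, Set.mem_Ioo] at hu
      push_cast at hu
      obtain ⟨hu1, hu2⟩ := hu
      simp only [gQ6]
      exact F3_fibre_A_zyx (by linarith) (by linarith) (by linarith) (by linarith) (by linarith)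
    · simp only [aQ6, Aff2.val, Set.mem_Ioo] at hu
      push_cast at hu
      obtain ⟨hu1, hu2⟩ := hu
      simp only [gQ6]
      exact F3_fibre_B_zyx (by linarith) (by linarith) (by linarith) (by linarith) (by linarith) (by linarith) (by linarith)
    · simp only [aQ6, Aff2.val, Set.mem_Ioo] at hu
      push_cast at hu
      obtain ⟨hu1, hu2⟩ := hu
      simp only [gQ6]
      exact F3_fibre_B_xyz (by linarith) (by linarith) (by linarith) (by linarith) (by linarith) (by linarith) (by linarith)
    · simp only [aQ6, Aff2.val, Set.mem_Ioo] at hu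
      push_cast at hu
      obtain ⟨hu1, hu2⟩ := hu
      simp only [gQ6]
      exact F3_fibre_C_xyz (by linarith) (by linarith) (by linarith) (by linarith) (by linarith) (by linarith) (by linarith)
    · simp only [aQ6, Aff2.val, Set.mem_Ioo] at hu
      push_cast at hu
      obtain ⟨hu1, hu2⟩ := hu
      simp only [gQ6]
      exact F3_fibre_S_xyz (by linarith) (by linarith) (by linarith) (by linarith) (by linarith) (by linarith) (by linarith) (by linarith) (by linarith)
    · simp only [aQ6, Aff2.val, Set.mem_Ioo] at hu
      push_cast at hu
      obtain ⟨hu1, hu2⟩ := hu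
      simp only [gQ6]
      exact F3_fibre_T_xyz (by linarith) (by linarith) (by linarith) (by linarith) (by linarith) (by linarith) (by linarith) (by linarith) (by linarith) (by linarith)
  · intro u hu
    simp only [aQ6, Aff2.val] at hu
    push_cast at hu
    exact F3_fibre_zero (by linarith)

/-- Breakpoints of the fibre over the region `Q7`. [cite: Polymath8b2014, Section 7.4] -/
def aQ7 (x y : ℝ) : ℕ → ℝ
  | 0 => ((⟨0, 0, 0⟩ : Aff2).val x y)
  | 1 => ((⟨0, 0, 1⟩ : Aff2).val x y)
  | 2 => ((⟨(3/4), (-1), 0⟩ : Aff2).val x y)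
  | 3 => ((⟨0, 1, 0⟩ : Aff2).val x y)
  | 4 => ((⟨(5/4), (-1), 0⟩ : Aff2).val x y)
  | 5 => ((⟨(3/4), 0, (-1)⟩ : Aff2).val x y)
  | 6 => ((⟨(3/4), 0, 0⟩ : Aff2).val x y)
  | _ => ((⟨(3/2), (-1), (-1)⟩ : Aff2).val x y)

/-- Pieces of the fibre over the region `Q7`. [cite: Polymath8b2014, Section 7.4] -/
def gQ7 (x y : ℝ) : ℕ → ℝ → ℝ
  | 0 => fun u => ev3 x y u qfA_yzx
  | 1 => fun u => ev3 x y u qfA_zyx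
  | 2 => fun u => ev3 x y u qfB_zyx
  | 3 => fun u => ev3 x y u qfB_xyz
  | 4 => fun u => ev3 x y u qfE_xyz
  | 5 => fun u => ev3 x y u qfS_xyz
  | _ => fun u => ev3 x y u qfT_xyz

/-- **The marginal polynomial on `Q7`** (a `Q2` term: the sum of the exact integrals of the pieces
between consecutive breakpoints). [cite: Polymath8b2014, Section 7.4] -/
def MQ7 : Q2 :=
  (ops2.add (ops2.add (ops2.add (ops2.add (ops2.add (ops2.add (ops2.lint qfA_yzx (⟨0, 0, 0⟩ : Aff2).toQ2 (⟨0, 0, 1⟩ : Aff2).toQ2) (ops2.lint qfA_zyx (⟨0, 0, 1⟩ : Aff2).toQ2 (⟨(3/4), (-1), 0⟩ : Aff2).toQ2)) (ops2.lint qfB_zyx (⟨(3/4), (-1), 0⟩ : Aff2).toQ2 (⟨0, 1, 0⟩ : Aff2).toQ2)) (ops2.lint qfB_xyz (⟨0, 1, 0⟩ : Aff2).toQ2 (⟨(5/4), (-1), 0⟩ : Aff2).toQ2)) (ops2.lint qfE_xyz (⟨(5/4), (-1), 0⟩ : Aff2).toQ2 (⟨(3/4), 0, (-1)⟩ : Aff2).toQ2))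 (ops2.lint qfS_xyz (⟨(3/4), 0, (-1)⟩ : Aff2).toQ2 (⟨(3/4), 0, 0⟩ : Aff2).toQ2)) (ops2.lint qfT_xyz (⟨(3/4), 0, 0⟩ : Aff2).toQ2 (⟨(3/2), (-1), (-1)⟩ : Aff2).toQ2))


/-- **The fibre structure over `Q7`**: for `(x, y)` in the open region, `m(x,y) = MQ7(x,y)`, the
fibre meeting `A_{yzx}` on `(0, y)`, `A_{zyx}` on `(y, 3/4 - x)`, `B_{zyx}` on `(3/4 - x, x)`, `B_{xyz}` on `(x, 5/4 - x)`, `E_{xyz}` on `(5/4 - x, 3/4 - y)`, `S_{xyz}` on `(3/4 - y, 3/4)`, `T_{xyz}` on `(3/4, 3/2 - x - y)`. [cite: Polymath8b2014, Section 7.4] -/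
theorem mfun_Q7 {x y : ℝ} (_r0 : 0 < x - 1/2) (_r1 : 0 < 5/8 - x) (_r2 : 0 < y) (_r3 : 0 < -1/2 + x - y) :
    mfun x y = ev2 x y MQ7 := by
  have key := setIntegral_Ioi_eq_sum_of_piecewise (integrable_fibre x y) (n := 7) (aQ7 x y) (gQ7 x y)
    (by simp [aQ7, Aff2.val]) ?_ ?_ ?_
  · rw [mfun, key]
    simp only [Finset.sum_range_succ, Finset.sum_range_zero, zero_add, aQ7, gQ7]
    rw [MQ7]
    rw [(lawful2 x y).add, (lawful2 x y).add, (lawful2 x y).add, (lawful2 x y).add, (lawful2 x y).add, (lawful2 x y).add]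
    rw [← integral_leval (lawful2 x y) qfA_yzx, ← integral_leval (lawful2 x y) qfA_zyx, ← integral_leval (lawful2 x y) qfB_zyx, ← integral_leval (lawful2 x y) qfB_xyz, ← integral_leval (lawful2 x y) qfE_xyz, ← integral_leval (lawful2 x y) qfS_xyz, ← integral_leval (lawful2 x y) qfT_xyz]
    simp only [Aff2.ev2_toQ2]
    rfl
  · intro k hk
    interval_cases k <;> simp only [aQ7, Aff2.val] <;> push_cast <;> linarith
  · intro k hk u hu
    interval_cases k
    · simp only [aQ7, Aff2.val, Set.mem_Ioo] at hu
      push_cast at hu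
      obtain ⟨hu1, hu2⟩ := hu
      simp only [gQ7]
      exact F3_fibre_A_yzx (by linarith) (by linarith) (by linarith) (by linarith) (by linarith)
    · simp only [aQ7, Aff2.val, Set.mem_Ioo] at hu
      push_cast at hu
      obtain ⟨hu1, hu2⟩ := hu
      simp only [gQ7]
      exact F3_fibre_A_zyx (by linarith) (by linarith) (by linarith) (by linarith) (by linarith)
    · simp only [aQ7, Aff2.val, Set.mem_Ioo] at hu
      push_cast at hu
      obtain ⟨hu1, hu2⟩ := hu
      simp only [gQ7]
      exact F3_fibre_B_zyx (by linarith) (by linarith) (by linarith) (by linarith) (by linarith) (by linarith) (by linarith)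
    · simp only [aQ7, Aff2.val, Set.mem_Ioo] at hu
      push_cast at hu
      obtain ⟨hu1, hu2⟩ := hu
      simp only [gQ7]
      exact F3_fibre_B_xyz (by linarith) (by linarith) (by linarith) (by linarith) (by linarith) (by linarith) (by linarith)
    · simp only [aQ7, Aff2.val, Set.mem_Ioo] at hu
      push_cast at hu
      obtain ⟨hu1, hu2⟩ := hu
      simp only [gQ7]
      exact F3_fibre_E_xyz (by linarith) (by linarith) (by linarith) (by linarith) (by linarith) (by linarith)
    · simp only [aQ7, Aff2.val, Set.mem_Ioo] at hu
      push_cast at hu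
      obtain ⟨hu1, hu2⟩ := hu
      simp only [gQ7]
      exact F3_fibre_S_xyz (by linarith) (by linarith) (by linarith) (by linarith) (by linarith) (by linarith) (by linarith) (by linarith) (by linarith)
    · simp only [aQ7, Aff2.val, Set.mem_Ioo] at hu
      push_cast at hu
      obtain ⟨hu1, hu2⟩ := hu
      simp only [gQ7]
      exact F3_fibre_T_xyz (by linarith) (by linarith) (by linarith) (by linarith) (by linarith) (by linarith) (by linarith) (by linarith) (by linarith) (by linarith)
  · intro u hu
    simp only [aQ7, Aff2.val] at hu
    push_cast at hu
    exact F3_fibre_zero (by linarith)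

/-- Breakpoints of the fibre over the region `Q8`. [cite: Polymath8b2014, Section 7.4] -/
def aQ8 (x y : ℝ) : ℕ → ℝ
  | 0 => ((⟨0, 0, 0⟩ : Aff2).val x y)
  | 1 => ((⟨0, 0, 1⟩ : Aff2).val x y)
  | 2 => ((⟨(3/4), (-1), 0⟩ : Aff2).val x y)
  | 3 => ((⟨(5/4), (-1), 0⟩ : Aff2).val x y)
  | 4 => ((⟨0, 1, 0⟩ : Aff2).val x y)
  | 5 => ((⟨(3/4), 0, (-1)⟩ : Aff2).val x y)
  | 6 => ((⟨(3/4), 0, 0⟩ : Aff2).val x y)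
  | _ => ((⟨(3/2), (-1), (-1)⟩ : Aff2).val x y)

/-- Pieces of the fibre over the region `Q8`. [cite: Polymath8b2014, Section 7.4] -/
def gQ8 (x y : ℝ) : ℕ → ℝ → ℝ
  | 0 => fun u => ev3 x y u qfA_yzx
  | 1 => fun u => ev3 x y u qfA_zyx
  | 2 => fun u => ev3 x y u qfB_zyx
  | 3 => fun u => ev3 x y u qfE_zyx
  | 4 => fun u => ev3 x y u qfE_xyz
  | 5 => fun u => ev3 x y u qfS_xyz
  | _ => fun u => ev3 x y u qfT_xyz

/-- **The marginal polynomial on `Q8`** (a `Q2` term: the sum of the exact integrals of the pieces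
between consecutive breakpoints). [cite: Polymath8b2014, Section 7.4] -/
def MQ8 : Q2 :=
  (ops2.add (ops2.add (ops2.add (ops2.add (ops2.add (ops2.add (ops2.lint qfA_yzx (⟨0, 0, 0⟩ : Aff2).toQ2 (⟨0, 0, 1⟩ : Aff2).toQ2) (ops2.lint qfA_zyx (⟨0, 0, 1⟩ : Aff2).toQ2 (⟨(3/4), (-1), 0⟩ : Aff2).toQ2)) (ops2.lint qfB_zyx (⟨(3/4), (-1), 0⟩ : Aff2).toQ2 (⟨(5/4), (-1), 0⟩ : Aff2).toQ2)) (ops2.lint qfE_zyx (⟨(5/4), (-1), 0⟩ : Aff2).toQ2 (⟨0, 1, 0⟩ : Aff2).toQ2)) (ops2.lint qfE_xyz (⟨0, 1, 0⟩ : Aff2).toQ2 (⟨(3/4), 0, (-1)⟩ : Aff2).toQ2)) (ops2.lint qfS_xyz (⟨(3/4), 0, (-1)⟩ : Aff2).toQ2 (⟨(3/4), 0, 0⟩ : Aff2).toQ2)) (ops2.lint qfT_xyz (⟨(3/4), 0, 0⟩ : Aff2).toQ2 (⟨(3/2), (-1), (-1)⟩ : Aff2).toQ2))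


/-- **The fibre structure over `Q8`**: for `(x, y)` in the open region, `m(x,y) = MQ8(x,y)`, the
fibre meeting `A_{yzx}` on `(0, y)`, `A_{zyx}` on `(y, 3/4 - x)`, `B_{zyx}` on `(3/4 - x, 5/4 - x)`, `E_{zyx}` on `(5/4 - x, x)`, `E_{xyz}` on `(x, 3/4 - y)`, `S_{xyz}` on `(3/4 - y, 3/4)`, `T_{xyz}` on `(3/4, 3/2 - x - y)`. [cite: Polymath8b2014, Section 7.4] -/
theorem mfun_Q8 {x y : ℝ} (_r0 : 0 < x - 5/8) (_r1 : 0 < 3/4 - x) (_r2 : 0 < y) (_r3 : 0 < 3/4 - x - y) :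
    mfun x y = ev2 x y MQ8 := by
  have key := setIntegral_Ioi_eq_sum_of_piecewise (integrable_fibre x y) (n := 7) (aQ8 x y) (gQ8 x y)
    (by simp [aQ8, Aff2.val]) ?_ ?_ ?_
  · rw [mfun, key]
    simp only [Finset.sum_range_succ, Finset.sum_range_zero, zero_add, aQ8, gQ8]
    rw [MQ8]
    rw [(lawful2 x y).add, (lawful2 x y).add, (lawful2 x y).add, (lawful2 x y).add, (lawful2 x y).add, (lawful2 x y).add]
    rw [← integral_leval (lawful2 x y) qfA_yzx, ← integral_leval (lawful2 x y) qfA_zyx, ← integral_leval (lawful2 x y) qfB_zyx, ← integral_leval (lawful2 x y) qfE_zyx, ← integral_leval (lawful2 x y) qfE_xyz, ← integral_leval (lawful2 x y) qfS_xyz, ← integral_leval (lawful2 x y) qfT_xyz]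
    simp only [Aff2.ev2_toQ2]
    rfl
  · intro k hk
    interval_cases k <;> simp only [aQ8, Aff2.val] <;> push_cast <;> linarith
  · intro k hk u hu
    interval_cases k
    · simp only [aQ8, Aff2.val, Set.mem_Ioo] at hu
      push_cast at hu
      obtain ⟨hu1, hu2⟩ := hu
      simp only [gQ8]
      exact F3_fibre_A_yzx (by linarith) (by linarith) (by linarith) (by linarith) (by linarith)
    · simp only [aQ8, Aff2.val, Set.mem_Ioo] at hu
      push_cast at hu
      obtain ⟨hu1, hu2⟩ := hu
      simp only [gQ8]
      exact F3_fibre_A_zyx (by linarith) (by linarith) (by linarith) (by linarith) (by linarith)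
    · simp only [aQ8, Aff2.val, Set.mem_Ioo] at hu
      push_cast at hu
      obtain ⟨hu1, hu2⟩ := hu
      simp only [gQ8]
      exact F3_fibre_B_zyx (by linarith) (by linarith) (by linarith) (by linarith) (by linarith) (by linarith) (by linarith)
    · simp only [aQ8, Aff2.val, Set.mem_Ioo] at hu
      push_cast at hu
      obtain ⟨hu1, hu2⟩ := hu
      simp only [gQ8]
      exact F3_fibre_E_zyx (by linarith) (by linarith) (by linarith) (by linarith) (by linarith) (by linarith)
    · simp only [aQ8, Aff2.val, Set.mem_Ioo] at hu
      push_cast at hu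
      obtain ⟨hu1, hu2⟩ := hu
      simp only [gQ8]
      exact F3_fibre_E_xyz (by linarith) (by linarith) (by linarith) (by linarith) (by linarith) (by linarith)
    · simp only [aQ8, Aff2.val, Set.mem_Ioo] at hu
      push_cast at hu
      obtain ⟨hu1, hu2⟩ := hu
      simp only [gQ8]
      exact F3_fibre_S_xyz (by linarith) (by linarith) (by linarith) (by linarith) (by linarith) (by linarith) (by linarith) (by linarith) (by linarith)
    · simp only [aQ8, Aff2.val, Set.mem_Ioo] at hu
      push_cast at hu
      obtain ⟨hu1, hu2⟩ := hu
      simp only [gQ8]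
      exact F3_fibre_T_xyz (by linarith) (by linarith) (by linarith) (by linarith) (by linarith) (by linarith) (by linarith) (by linarith) (by linarith) (by linarith)
  · intro u hu
    simp only [aQ8, Aff2.val] at hu
    push_cast at hu
    exact F3_fibre_zero (by linarith)

/-- Breakpoints of the fibre over the region `R1`. [cite: Polymath8b2014, Section 7.4] -/
def aR1 (x y : ℝ) : ℕ → ℝ
  | 0 => ((⟨0, 0, 0⟩ : Aff2).val x y)
  | 1 => ((⟨(3/4), (-1), 0⟩ : Aff2).val x y)
  | 2 => ((⟨(3/4), 0, (-1)⟩ : Aff2).val x y)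
  | _ => ((⟨(3/2), (-1), (-1)⟩ : Aff2).val x y)

/-- Pieces of the fibre over the region `R1`. [cite: Polymath8b2014, Section 7.4] -/
def gR1 (x y : ℝ) : ℕ → ℝ → ℝ
  | 0 => fun u => ev3 x y u qfE_yzx
  | 1 => fun u => ev3 x y u qfS_yzx
  | _ => fun u => ev3 x y u qfH_yzx

/-- **The marginal polynomial on `R1`** (a `Q2` term: the sum of the exact integrals of the pieces
between consecutive breakpoints). [cite: Polymath8b2014, Section 7.4] -/
def MR1 : Q2 :=
  (ops2.add (ops2.add (ops2.lint qfE_yzx (⟨0, 0, 0⟩ : Aff2).toQ2 (⟨(3/4), (-1), 0⟩ : Aff2).toQ2) (ops2.lint qfS_yzx (⟨(3/4), (-1), 0⟩ : Aff2).toQ2 (⟨(3/4), 0, (-1)⟩ : Aff2).toQ2)) (ops2.lint qfH_yzx (⟨(3/4), 0, (-1)⟩ : Aff2).toQ2 (⟨(3/2), (-1), (-1)⟩ : Aff2).toQ2))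


/-- **The fibre structure over `R1`**: for `(x, y)` in the open region, `m(x,y) = MR1(x,y)`, the
fibre meeting `E_{yzx}` on `(0, 3/4 - x)`, `S_{yzx}` on `(3/4 - x, 3/4 - y)`, `H_{yzx}` on `(3/4 - y, 3/2 - x - y)`. [cite: Polymath8b2014, Section 7.4] -/
theorem mfun_R1 {x y : ℝ} (_r0 : 0 < y) (_r1 : 0 < x - y) (_r2 : 0 < x + y - 5/4) (_r3 : 0 < 3/2 - x - y) (_r4 : 0 < 3/4 - x) :
    mfun x y = ev2 x y MR1 := by
  have key := setIntegral_Ioi_eq_sum_of_piecewise (integrable_fibre x y) (n := 3) (aR1 x y) (gR1 x y)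
    (by simp [aR1, Aff2.val]) ?_ ?_ ?_
  · rw [mfun, key]
    simp only [Finset.sum_range_succ, Finset.sum_range_zero, zero_add, aR1, gR1]
    rw [MR1]
    rw [(lawful2 x y).add, (lawful2 x y).add]
    rw [← integral_leval (lawful2 x y) qfE_yzx, ← integral_leval (lawful2 x y) qfS_yzx, ← integral_leval (lawful2 x y) qfH_yzx]
    simp only [Aff2.ev2_toQ2]
    rfl
  · intro k hk
    interval_cases k <;> simp only [aR1, Aff2.val] <;> push_cast <;> linarith
  · intro k hk u hu
    interval_cases k
    · simp only [aR1, Aff2.val, Set.mem_Ioo] at hu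
      push_cast at hu
      obtain ⟨hu1, hu2⟩ := hu
      simp only [gR1]
      exact F3_fibre_E_yzx (by linarith) (by linarith) (by linarith) (by linarith) (by linarith) (by linarith)
    · simp only [aR1, Aff2.val, Set.mem_Ioo] at hu
      push_cast at hu
      obtain ⟨hu1, hu2⟩ := hu
      simp only [gR1]
      exact F3_fibre_S_yzx (by linarith) (by linarith) (by linarith) (by linarith) (by linarith) (by linarith) (by linarith) (by linarith) (by linarith)
    · simp only [aR1, Aff2.val, Set.mem_Ioo] at hu
      push_cast at hu
      obtain ⟨hu1, hu2⟩ := hu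
      simp only [gR1]
      exact F3_fibre_H_yzx (by linarith) (by linarith) (by linarith) (by linarith) (by linarith) (by linarith) (by linarith)
  · intro u hu
    simp only [aR1, Aff2.val] at hu
    push_cast at hu
    exact F3_fibre_zero (by linarith)

/-- Breakpoints of the fibre over the region `R3`. [cite: Polymath8b2014, Section 7.4] -/
def aR3 (x y : ℝ) : ℕ → ℝ
  | 0 => ((⟨0, 0, 0⟩ : Aff2).val x y)
  | _ => ((⟨(3/2), (-1), (-1)⟩ : Aff2).val x y)

/-- Pieces of the fibre over the region `R3`. [cite: Polymath8b2014, Section 7.4] -/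
def gR3 (x y : ℝ) : ℕ → ℝ → ℝ
  | _ => fun u => ev3 x y u qfT_yzx

/-- **The marginal polynomial on `R3`** (a `Q2` term: the sum of the exact integrals of the pieces
between consecutive breakpoints). [cite: Polymath8b2014, Section 7.4] -/
def MR3 : Q2 :=
  (ops2.lint qfT_yzx (⟨0, 0, 0⟩ : Aff2).toQ2 (⟨(3/2), (-1), (-1)⟩ : Aff2).toQ2)


/-- **The fibre structure over `R3`**: for `(x, y)` in the open region, `m(x,y) = MR3(x,y)`, the
fibre meeting `T_{yzx}` on `(0, 3/2 - x - y)`. [cite: Polymath8b2014, Section 7.4] -/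
theorem mfun_R3 {x y : ℝ} (_r0 : 0 < y) (_r1 : 0 < x - y) (_r2 : 0 < x + y - 5/4) (_r3 : 0 < 3/2 - x - y) (_r4 : 0 < x - 3/4) (_r5 : 0 < y - 1/4) :
    mfun x y = ev2 x y MR3 := by
  have key := setIntegral_Ioi_eq_sum_of_piecewise (integrable_fibre x y) (n := 1) (aR3 x y) (gR3 x y)
    (by simp [aR3, Aff2.val]) ?_ ?_ ?_
  · rw [mfun, key]
    simp only [Finset.sum_range_succ, Finset.sum_range_zero, zero_add, aR3, gR3]
    rw [MR3]
    rw [← integral_leval (lawful2 x y) qfT_yzx]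
    simp only [Aff2.ev2_toQ2]
    rfl
  · intro k hk
    interval_cases k
    simp only [aR3, Aff2.val]
    push_cast
    linarith
  · intro k hk u hu
    interval_cases k
    · simp only [aR3, Aff2.val, Set.mem_Ioo] at hu
      push_cast at hu
      obtain ⟨hu1, hu2⟩ := hu
      simp only [gR3]
      exact F3_fibre_T_yzx (by linarith) (by linarith) (by linarith) (by linarith) (by linarith) (by linarith) (by linarith) (by linarith) (by linarith) (by linarith)
  · intro u hu
    simp only [aR3, Aff2.val] at hu
    push_cast at hu
    exact F3_fibre_zero (by linarith)

/-- Breakpoints of the fibre over the region `R4`. [cite: Polymath8b2014, Section 7.4] -/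
def aR4 (x y : ℝ) : ℕ → ℝ
  | 0 => ((⟨0, 0, 0⟩ : Aff2).val x y)
  | 1 => ((⟨(5/4), (-1), 0⟩ : Aff2).val x y)
  | 2 => ((⟨0, 0, 1⟩ : Aff2).val x y)
  | _ => ((⟨(3/2), (-1), (-1)⟩ : Aff2).val x y)

/-- Pieces of the fibre over the region `R4`. [cite: Polymath8b2014, Section 7.4] -/
def gR4 (x y : ℝ) : ℕ → ℝ → ℝ
  | 0 => fun u => ev3 x y u qfU_yzx
  | 1 => fun u => ev3 x y u qfG_yzx
  | _ => fun u => ev3 x y u qfG_zyx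

/-- **The marginal polynomial on `R4`** (a `Q2` term: the sum of the exact integrals of the pieces
between consecutive breakpoints). [cite: Polymath8b2014, Section 7.4] -/
def MR4 : Q2 :=
  (ops2.add (ops2.add (ops2.lint qfU_yzx (⟨0, 0, 0⟩ : Aff2).toQ2 (⟨(5/4), (-1), 0⟩ : Aff2).toQ2) (ops2.lint qfG_yzx (⟨(5/4), (-1), 0⟩ : Aff2).toQ2 (⟨0, 0, 1⟩ : Aff2).toQ2)) (ops2.lint qfG_zyx (⟨0, 0, 1⟩ : Aff2).toQ2 (⟨(3/2), (-1), (-1)⟩ : Aff2).toQ2))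


/-- **The fibre structure over `R4`**: for `(x, y)` in the open region, `m(x,y) = MR4(x,y)`, the
fibre meeting `U_{yzx}` on `(0, 5/4 - x)`, `G_{yzx}` on `(5/4 - x, y)`, `G_{zyx}` on `(y, 3/2 - x - y)`. [cite: Polymath8b2014, Section 7.4] -/
theorem mfun_R4 {x y : ℝ} (_r0 : 0 < y) (_r1 : 0 < x - y) (_r2 : 0 < x + y - 5/4) (_r3 : 0 < 3/2 - x - y) (_r4 : 0 < 1/4 - y) (_r5 : 0 < 5/4 - x) (_r6 : 0 < 3/2 - x - 2 * y) :
    mfun x y = ev2 x y MR4 := by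
  have key := setIntegral_Ioi_eq_sum_of_piecewise (integrable_fibre x y) (n := 3) (aR4 x y) (gR4 x y)
    (by simp [aR4, Aff2.val]) ?_ ?_ ?_
  · rw [mfun, key]
    simp only [Finset.sum_range_succ, Finset.sum_range_zero, zero_add, aR4, gR4]
    rw [MR4]
    rw [(lawful2 x y).add, (lawful2 x y).add]
    rw [← integral_leval (lawful2 x y) qfU_yzx, ← integral_leval (lawful2 x y) qfG_yzx, ← integral_leval (lawful2 x y) qfG_zyx]
    simp only [Aff2.ev2_toQ2]
    rfl
  · intro k hk
    interval_cases k <;> simp only [aR4, Aff2.val] <;> push_cast <;> linarith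
  · intro k hk u hu
    interval_cases k
    · simp only [aR4, Aff2.val, Set.mem_Ioo] at hu
      push_cast at hu
      obtain ⟨hu1, hu2⟩ := hu
      simp only [gR4]
      exact F3_fibre_U_yzx (by linarith) (by linarith) (by linarith) (by linarith) (by linarith) (by linarith) (by linarith) (by linarith) (by linarith)
    · simp only [aR4, Aff2.val, Set.mem_Ioo] at hu
      push_cast at hu
      obtain ⟨hu1, hu2⟩ := hu
      simp only [gR4]
      exact F3_fibre_G_yzx (by linarith) (by linarith) (by linarith) (by linarith) (by linarith) (by linarith)
    · simp only [aR4, Aff2.val, Set.mem_Ioo] at hu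
      push_cast at hu
      obtain ⟨hu1, hu2⟩ := hu
      simp only [gR4]
      exact F3_fibre_G_zyx (by linarith) (by linarith) (by linarith) (by linarith) (by linarith) (by linarith)
  · intro u hu
    simp only [aR4, Aff2.val] at hu
    push_cast at hu
    exact F3_fibre_zero (by linarith)

/-- Breakpoints of the fibre over the region `R5`. [cite: Polymath8b2014, Section 7.4] -/
def aR5 (x y : ℝ) : ℕ → ℝ
  | 0 => ((⟨0, 0, 0⟩ : Aff2).val x y)
  | 1 => ((⟨(5/4), (-1), 0⟩ : Aff2).val x y)
  | _ => ((⟨(3/2), (-1), (-1)⟩ : Aff2).val x y)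

/-- Pieces of the fibre over the region `R5`. [cite: Polymath8b2014, Section 7.4] -/
def gR5 (x y : ℝ) : ℕ → ℝ → ℝ
  | 0 => fun u => ev3 x y u qfU_yzx
  | _ => fun u => ev3 x y u qfG_yzx

/-- **The marginal polynomial on `R5`** (a `Q2` term: the sum of the exact integrals of the pieces
between consecutive breakpoints). [cite: Polymath8b2014, Section 7.4] -/
def MR5 : Q2 :=
  (ops2.add (ops2.lint qfU_yzx (⟨0, 0, 0⟩ : Aff2).toQ2 (⟨(5/4), (-1), 0⟩ : Aff2).toQ2) (ops2.lint qfG_yzx (⟨(5/4), (-1), 0⟩ : Aff2).toQ2 (⟨(3/2), (-1), (-1)⟩ : Aff2).toQ2))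


/-- **The fibre structure over `R5`**: for `(x, y)` in the open region, `m(x,y) = MR5(x,y)`, the
fibre meeting `U_{yzx}` on `(0, 5/4 - x)`, `G_{yzx}` on `(5/4 - x, 3/2 - x - y)`. [cite: Polymath8b2014, Section 7.4] -/
theorem mfun_R5 {x y : ℝ} (_r0 : 0 < y) (_r1 : 0 < x - y) (_r2 : 0 < x + y - 5/4) (_r3 : 0 < 3/2 - x - y) (_r4 : 0 < 1/4 - y) (_r5 : 0 < 5/4 - x) (_r6 : 0 < x + 2 * y - 3/2) :
    mfun x y = ev2 x y MR5 := by
  have key := setIntegral_Ioi_eq_sum_of_piecewise (integrable_fibre x y) (n := 2) (aR5 x y) (gR5 x y)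
    (by simp [aR5, Aff2.val]) ?_ ?_ ?_
  · rw [mfun, key]
    simp only [Finset.sum_range_succ, Finset.sum_range_zero, zero_add, aR5, gR5]
    rw [MR5]
    rw [(lawful2 x y).add]
    rw [← integral_leval (lawful2 x y) qfU_yzx, ← integral_leval (lawful2 x y) qfG_yzx]
    simp only [Aff2.ev2_toQ2]
    rfl
  · intro k hk
    interval_cases k <;> simp only [aR5, Aff2.val] <;> push_cast <;> linarith
  · intro k hk u hu
    interval_cases k
    · simp only [aR5, Aff2.val, Set.mem_Ioo] at hu
      push_cast at hu
      obtain ⟨hu1, hu2⟩ := hu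
      simp only [gR5]
      exact F3_fibre_U_yzx (by linarith) (by linarith) (by linarith) (by linarith) (by linarith) (by linarith) (by linarith) (by linarith) (by linarith)
    · simp only [aR5, Aff2.val, Set.mem_Ioo] at hu
      push_cast at hu
      obtain ⟨hu1, hu2⟩ := hu
      simp only [gR5]
      exact F3_fibre_G_yzx (by linarith) (by linarith) (by linarith) (by linarith) (by linarith) (by linarith)
  · intro u hu
    simp only [aR5, Aff2.val] at hu
    push_cast at hu
    exact F3_fibre_zero (by linarith)

/-- Breakpoints of the fibre over the region `R6`. [cite: Polymath8b2014, Section 7.4] -/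
def aR6 (x y : ℝ) : ℕ → ℝ
  | 0 => ((⟨0, 0, 0⟩ : Aff2).val x y)
  | 1 => ((⟨0, 0, 1⟩ : Aff2).val x y)
  | _ => ((⟨(3/2), (-1), (-1)⟩ : Aff2).val x y)

/-- Pieces of the fibre over the region `R6`. [cite: Polymath8b2014, Section 7.4] -/
def gR6 (x y : ℝ) : ℕ → ℝ → ℝ
  | 0 => fun u => ev3 x y u qfG_yzx
  | _ => fun u => ev3 x y u qfG_zyx

/-- **The marginal polynomial on `R6`** (a `Q2` term: the sum of the exact integrals of the pieces
between consecutive breakpoints). [cite: Polymath8b2014, Section 7.4] -/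
def MR6 : Q2 :=
  (ops2.add (ops2.lint qfG_yzx (⟨0, 0, 0⟩ : Aff2).toQ2 (⟨0, 0, 1⟩ : Aff2).toQ2) (ops2.lint qfG_zyx (⟨0, 0, 1⟩ : Aff2).toQ2 (⟨(3/2), (-1), (-1)⟩ : Aff2).toQ2))


/-- **The fibre structure over `R6`**: for `(x, y)` in the open region, `m(x,y) = MR6(x,y)`, the
fibre meeting `G_{yzx}` on `(0, y)`, `G_{zyx}` on `(y, 3/2 - x - y)`. [cite: Polymath8b2014, Section 7.4] -/
theorem mfun_R6 {x y : ℝ} (_r0 : 0 < y) (_r1 : 0 < x - y) (_r2 : 0 < x + y - 5/4) (_r3 : 0 < 3/2 - x - y) (_r4 : 0 < x - 5/4) (_r5 : 0 < 3/2 - x - 2 * y) :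
    mfun x y = ev2 x y MR6 := by
  have key := setIntegral_Ioi_eq_sum_of_piecewise (integrable_fibre x y) (n := 2) (aR6 x y) (gR6 x y)
    (by simp [aR6, Aff2.val]) ?_ ?_ ?_
  · rw [mfun, key]
    simp only [Finset.sum_range_succ, Finset.sum_range_zero, zero_add, aR6, gR6]
    rw [MR6]
    rw [(lawful2 x y).add]
    rw [← integral_leval (lawful2 x y) qfG_yzx, ← integral_leval (lawful2 x y) qfG_zyx]
    simp only [Aff2.ev2_toQ2]
    rfl
  · intro k hk
    interval_cases k <;> simp only [aR6, Aff2.val] <;> push_cast <;> linarith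
  · intro k hk u hu
    interval_cases k
    · simp only [aR6, Aff2.val, Set.mem_Ioo] at hu
      push_cast at hu
      obtain ⟨hu1, hu2⟩ := hu
      simp only [gR6]
      exact F3_fibre_G_yzx (by linarith) (by linarith) (by linarith) (by linarith) (by linarith) (by linarith)
    · simp only [aR6, Aff2.val, Set.mem_Ioo] at hu
      push_cast at hu
      obtain ⟨hu1, hu2⟩ := hu
      simp only [gR6]
      exact F3_fibre_G_zyx (by linarith) (by linarith) (by linarith) (by linarith) (by linarith) (by linarith)
  · intro u hu
    simp only [aR6, Aff2.val] at hu
    push_cast at hu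
    exact F3_fibre_zero (by linarith)

/-- Breakpoints of the fibre over the region `R7`. [cite: Polymath8b2014, Section 7.4] -/
def aR7 (x y : ℝ) : ℕ → ℝ
  | 0 => ((⟨0, 0, 0⟩ : Aff2).val x y)
  | _ => ((⟨(3/2), (-1), (-1)⟩ : Aff2).val x y)

/-- Pieces of the fibre over the region `R7`. [cite: Polymath8b2014, Section 7.4] -/
def gR7 (x y : ℝ) : ℕ → ℝ → ℝ
  | _ => fun u => ev3 x y u qfG_yzx

/-- **The marginal polynomial on `R7`** (a `Q2` term: the sum of the exact integrals of the pieces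
between consecutive breakpoints). [cite: Polymath8b2014, Section 7.4] -/
def MR7 : Q2 :=
  (ops2.lint qfG_yzx (⟨0, 0, 0⟩ : Aff2).toQ2 (⟨(3/2), (-1), (-1)⟩ : Aff2).toQ2)


/-- **The fibre structure over `R7`**: for `(x, y)` in the open region, `m(x,y) = MR7(x,y)`, the
fibre meeting `G_{yzx}` on `(0, 3/2 - x - y)`. [cite: Polymath8b2014, Section 7.4] -/
theorem mfun_R7 {x y : ℝ} (_r0 : 0 < y) (_r1 : 0 < x - y) (_r2 : 0 < x + y - 5/4) (_r3 : 0 < 3/2 - x - y) (_r4 : 0 < x - 5/4) (_r5 : 0 < x + 2 * y - 3/2) :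
    mfun x y = ev2 x y MR7 := by
  have key := setIntegral_Ioi_eq_sum_of_piecewise (integrable_fibre x y) (n := 1) (aR7 x y) (gR7 x y)
    (by simp [aR7, Aff2.val]) ?_ ?_ ?_
  · rw [mfun, key]
    simp only [Finset.sum_range_succ, Finset.sum_range_zero, zero_add, aR7, gR7]
    rw [MR7]
    rw [← integral_leval (lawful2 x y) qfG_yzx]
    simp only [Aff2.ev2_toQ2]
    rfl
  · intro k hk
    interval_cases k
    simp only [aR7, Aff2.val]
    push_cast
    linarith
  · intro k hk u hu
    interval_cases k
    · simp only [aR7, Aff2.val, Set.mem_Ioo] at hu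
      push_cast at hu
      obtain ⟨hu1, hu2⟩ := hu
      simp only [gR7]
      exact F3_fibre_G_yzx (by linarith) (by linarith) (by linarith) (by linarith) (by linarith) (by linarith)
  · intro u hu
    simp only [aR7, Aff2.val] at hu
    push_cast at hu
    exact F3_fibre_zero (by linarith)

end GEHCutoff

end Literature.NumberTheory.Sieve
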